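import Summits.Parity.GeneralizedHardyLittlewood.Theorems.GoldbachHeathBrownDispersionHeathBrownMorozUniformOfClassLemmas
import Summits.Parity.GeneralizedHardyLittlewood.Theorems.GoldbachHeathBrownDispersionHeathBrownMorozUniformSigmaOneCoprime
import Summits.Parity.GeneralizedHardyLittlewood.Theorems.GoldbachHeathBrownDispersionHeathBrownMorozUniformClassDisplay104
import Summits.Parity.GeneralizedHardyLittlewood.Theorems.GoldbachHeathBrownDispersionHeathBrownMorozUniformClassMainError
import Summits.Parity.GeneralizedHardyLittlewood.Theorems.GoldbachHeathBrownDispersionHeathBrownMorozUniformClassMainCauchy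
import Summits.Parity.GeneralizedHardyLittlewood.Theorems.GoldbachHeathBrownDispersionHeathBrownMorozUniformTwistedSsum
import Literature.NumberTheory.Sieve.HeathBrownCubicTypeIIFinal
import Literature.NumberTheory.Sieve.HeathBrownCubicLemma35Holds
import Literature.NumberTheory.Sieve.HeathBrownCubicLeadingA
import Literature.NumberTheory.Sieve.HeathBrownCubicPrimesProofs
import Literature.NumberTheory.Sieve.HeathBrownMorozResidueClassesSieve
import Literature.NumberTheory.Sieve.HeathBrownMorozClassTypeI
import Literature.NumberTheory.Sieve.HeathBrownMorozClassPairCount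
import Literature.NumberTheory.Sieve.HeathBrownMorozClassLemma35
import HarnessLib

/-!
# Line `unit-split-positivity` — crux `HeathBrownMorozUniform` (item stmt-Parity-19915), CRUX-PLAN skeleton v6:
# LINE CLOSED — ZERO stubs, ZERO `sorry`: all five stubs (S3, S4b, E3, E4, E5) are landed `Theorems/` theorems, S2, S4a
# PROVED here, and `heathBrownMorozUniform_holds` below is a complete kernel-checked proof of the crux BY NAME

Route `GoldbachHeathBrownDispersion` (Parity / GeneralizedHardyLittlewood); crux
`Summit.Parity.GeneralizedHardyLittlewood.Theses.GoldbachHeathBrownDispersion.HeathBrownMorozUniform`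
(Heath-Brown–Moroz 2004, Theorem 2 for `x³ + 2y³`: the primes of Heath-Brown's sequence are asymptotically
distributed over the admissible classes `(a, b) mod d`, box exponent uniform over the classes of one modulus `d ≤ Q`).
Planner seat `cruxplan-stmt-Parity-19915-unit-split-positivity` (g0 v1 17:14Z · g1 v2–v4 18:25–18:52Z · g2 card v5 ·
g3 v5 ≈20:00Z · g4 = this v6, 2026-08-27 ≈20:35Z, after E5 landed as p565095).  Card: `Lines/unit-split-positivity.md`.

**Goldbach is not proved by this.**  The crux is one INPUT of a FRONTIER route whose leaf is the almost-all rung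
`GoldbachHeathBrownAlmostAll` (Heath-Brown–Moroz 2004, Theorem 2 ⇒ almost all `n ≤ N` are `p + π` with `π` a prime
value of `x³ + 2y³` — the formalisation of a published theorem), not the summit `Parity`, not binary Goldbach.
What this v6 file does prove, with no `sorry` and no hypothesis, is the crux decl
`Summit.Parity.GeneralizedHardyLittlewood.Theses.GoldbachHeathBrownDispersion.HeathBrownMorozUniform` itself
(`heathBrownMorozUniform_holds`, last theorem).  Cruxes modules are not importable, so the ledger ITEM stmt-Parity-19915
still closes through a `Theorems/` file (the lead's closer, same composition); this file is the line's record.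

## Status of this file (v6) and of the registry

* v6 = v5 with the ONE remaining `sorry` discharged: E5 `stub_twistedSsum` LANDED as
  `Summit.Parity.GeneralizedHardyLittlewood.Theorems.GoldbachHeathBrownDispersionHeathBrownMorozUniform.stub_twistedSsum`
  (p565095 ACCEPTED 2026-08-27T20:24Z, lead `parity-ideate-ghb-prover-1` g3, std axioms; statement = the registered
  signature `Sig.stub_twistedSsum` VERBATIM, over the twisted §§11–13 port `Literature/NumberTheory/Sieve/HeathBrownCubicTwisted
  {Defs,Cauchy,Localise,SmallQ,ClassISum,UstarBound,S4Bound,Ssum}` p559220 … p564660, `CubicSieve.Twisted.Ssum_le_of_params`).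
  Below: `twistedSsum_holds : Sig.stub_twistedSsum := <that decl>` and `heathBrownMorozUniform_holds : HeathBrownMorozUniform`
  (0 `sorry`).  No `stub_*` declaration remains in this file.
* REGISTRY (one skeleton per crux): the registered file of record is the sibling seat's UNION
  `Lines/parent_differencing.lean` (namespace `…Cruxes.HeathBrownMorozUniform.ParentDifferencing`; v6 sha `7ac12a7f35b5…`,
  registered 19:58:24Z with the single stub E5, which the gate retired `gate:landed` at 20:24:33Z ⇒ the crux has ZERO active
  registered stubs).  This file is the line's own mirror and is deliberately NOT `skeleton check`ed (g1/g2 agreement: no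
  registry ping-pong); with no `stub_*` left there is nothing to register anyway.
* CLOSED, each by ONE line on a landed theorem whose TYPE is the stub statement unfolded verbatim:
  S3 `ClassSigmaOneCoprime` ↦ `sigmaOneCoprime_holds := classSigmaOneCoprime` (p560964 + p559789, `ghb-stub-sigma1-p1`);
  S4b `ClassTypeISqfreeSum → ClassSigmaOneCoprime → ClassDisplay104` ↦ `classDisplay104_of_hyps :=
  classDisplay104_of_typeISqfreeSum_of_sigmaOneCoprime` (p562472 over p557644 / p559714 / p561076 / p561315,
  `ghb-stub-display104-p1`); E3 `Sig.stub_classMainError` ↦ `classMainError_holds := ….Theorems.….stub_classMainError`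
  (p562045, lead); E4 `Sig.stub_classMainCauchy` ↦ `classMainCauchy_holds := ….Theorems.….stub_classMainCauchy` (p562571, lead);
  E5 `Sig.stub_twistedSsum` ↦ `twistedSsum_holds := ….Theorems.….stub_twistedSsum` (p565095, lead).  S2 (EQ35) and S4a were
  PROVED in v4 (`flDifferencing_holds` from the landed `class_lemma_3_5` p555871; `classTypeISqfreeSum_holds` from
  `class_typeI_A` p551644).
* Compositions (kernel-checked, no `sorry` anywhere): the 5-ary `HeathBrownMorozUniform_of` (v4), the 6-ary
  `HeathBrownMorozUniform_of₆` (v3), the sibling's 4-ary `HeathBrownMorozUniform_of_parentLine`, `HeathBrownMorozUniform_of_twisted :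
  Sig.stub_twistedSsum → HeathBrownMorozUniform` (v5), and NEW in v6 the closed instance `heathBrownMorozUniform_holds`.
* Closing the ledger ITEM is a `Theorems/` job, not this file's (Cruxes modules are not importable): the lead's closer
  re-derives `h39` (landed twice: `class_h39` p565223 / `classDisplay104_holds`-based `classH39_holds` p565492 — import exactly ONE
  of `…H39.lean` / `…ClassH39.lean`, they share statement-identical FQNs), `h35` from `class_lemma_3_5`, `h310` from E3/E4/E5 +
  the Part-B bookkeeping below (`classSV_le_of_params` … `h310_of`; the lead's prepared `Theorems/…HeathBrownMorozUniformH310.lean`),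
  and applies `heathBrownMorozUniform_of_classLemmas` (p544930) `--workitem stmt-Parity-19915`; then the one-line closers of
  stmt-Parity-20702 (`parity-romanoff-p2`, ⇐ p564021) / stmt-Parity-19908 (lead, ⇐ p563698).

## Where the two halves enter (unchanged since v3)

The tree PROVES (`heathBrownMorozUniform_of_classLemmas`, p544930) that the crux follows from three class lemmas
for every reduced admissible class `(d, a, b)`: `h35` (class FL terms), `h39` (class leading parts), `h310`
(class Type II = Heath-Brown's Lemma 3.10 for `classPairs X η d a b` under (3.14) up to `d·Q₁`).

* `h35`, `h39` — **parent differencing** (sibling line): compare the class with the PARENT family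
  `boxPairs X η ⊇ classPairs X η d a b` at the same height scaled by `w(d)/d²`; the tree's PROVED parent Lemmas
  3.5 / 3.9 / display (10.4) carry the `ℬ`-side; EQ35 (`flDifferencing_holds`), `Σ₁^{(d)}` (S3) and the class display
  (10.4) (S4b, Type-I input S4a `classTypeISqfreeSum_holds`) are now all theorems; glue `h35_of_flDifferencing`,
  `classLeadingDifferencing_of_display104`, `h39_of_leadingDifferencing` PROVED (sibling's text, copied verbatim in v3).
* `h310` — **residue split + positivity + twisted dispersion** (this line): after passing to generators
  `γ = αβ` (tree `mainMV_eq_sum_cA_innerSum`), the class condition on `γ̂ = α̂·β̂` depends only on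
  `(α̂ mod d, β̂ mod d)`; splitting the inner sum over the `d³` residues `v` of `β̂ (mod d)` makes the class
  indicator a function of `(α̂, v)` bounded by `1`, which dies in Cauchy exactly as `|c_α| ≤ 1` does on p. 68:
  `|M_V^{cl}| ≤ (#Abox)^{1/2} Σ_v S(v)^{1/2}` (E4, landed), with the TWISTED dispersion sum
  `S(v) = Σ_{α̂ prim}|Σ_{β̂ ≡ v (d)} F_β W(α̂β̂)|²` bounded by the four-term bound of `Ssum_le_of_params` under
  `Hyp314` at level `d·Q₁` (E5 `stub_twistedSsum`, LOAD-BEARING, LANDED p565095: the twist rides through §§11–13 because `F` is used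
  only through `|F_β| ≤ 9τ((β))`, its support and (3.14), where a class `β̂ ≡ c (q), g ∣ β̂, β̂ ≡ r (d)` is one
  class modulo `lcm(g,q,d) ≤ d·Q₁` — the lead's landed `Twisted.filter_dvd_red_red_eq`, `Twisted.lcm_lcm_le`,
  `Twisted.norm_Ag_le` with constant `d³C₁`); the class Möbius error has the d = 1 majorant (E3, landed); the
  bookkeeping `T = V^{1/3}`, `final_param_ineqs`, `Y = Q₁^{1/80}` is PROVED (`classSV_le_of_params`,
  `class_p83`, `class_310`, `h310_of`).

## References

* D. R. Heath-Brown, *Primes represented by `x³ + 2y³`*, Acta Math. 186 (2001) 1–84, Lemmas 3.2, 3.5, 3.9,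
  3.10, §10 pp. 60–64, §§11–13. [cite: HeathBrownActa2001, Lemma 3.10, §11 pp. 66–68, §13 pp. 82–83]
* D. R. Heath-Brown, B. Z. Moroz, *On the representation of primes by cubic polynomials in two variables*,
  Proc. LMS 88 (2004) 289–312, Theorem 2, §3, Lemma 4.1, Prop. 4.2. [cite: HeathBrownMoroz2004, Theorem 2]
-/

noncomputable section

open Polynomial NumberField Finset Filter Topology Asymptotics

namespace Summit.Parity.GeneralizedHardyLittlewood.Cruxes.HeathBrownMorozUniform.UnitSplitPositivity

open Literature.NumberTheory.Sieve.CubicSieve Literature.NumberTheory.Sieve.CubicPrimes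
open Literature.NumberTheory.LFunctions.CubeRootTwoField
open Summit.Parity.GeneralizedHardyLittlewood.Theorems.GoldbachHeathBrownDispersionHeathBrownMorozUniform

/-! ## Part A — the linear-sieve half (sibling line `parent-differencing` v2, copied VERBATIM from
`Lines/parent_differencing.lean`, namespace changed only; that file carries the canonical commentary) -/

/-! ### The statements: four stubs, the seams EQ39 / S4a they are cut at, and the direct `h35` -/

/-- **S2 conclusion — EQ35, the differenced Fundamental-Lemma terms.** For every reduced admissible class
and `ϖ ∈ (0, 1/5)` there are `C, X₀` with, for `X ≥ X₀`, `η` in (2.1), `τ = (log log X)^{−ϖ}`, `n₀ = ⌊1/τ⌋ + 1`: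
`∑_{n ≤ n₀} |T⁽ⁿ⁾(𝒜_cl) − (w(d)/d²)·T⁽ⁿ⁾(𝒜)| ≤ C τ η²X²/log X` — NO `σ₀`, no `ℬ`: both sides are sifted by the
two-sided Fundamental Lemma with the SAME sifting range; for `X^τ > d` every chain prime has norm coprime to
`d`, so the two main terms are `X_cl·E_{X^τ}(d)·(…)` and `(w/d²)·X_𝒜·(…)` with
`X_cl·E(d) = (6η²X²/π²)(ζ(2)/ζ_d(2))d⁻²·coprimeClassWeight d = (w/d²)X_𝒜` — they cancel identically
(`coprimeClassWeight_mul_zetaTwoCorrection`); only the two FL errors and the two Type-I remainder sums survive.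
[cite: HeathBrownMoroz2004, Lemma 3.1] [cite: HeathBrownActa2001, Lemma 3.5 and §6] -/
def ClassFLDifferencing : Prop :=
  ∀ d a b : ℕ, 0 < d → a < d → b < d → Nat.Coprime (a ^ 3 + 2 * b ^ 3) d →
    ∀ ϖ : ℝ, 0 < ϖ → ϖ < 1 / 5 →
      ∃ C X₀ : ℝ, ∀ X η : ℝ, X₀ ≤ X → Real.exp (-Real.log X ^ (1 / 3 : ℝ)) ≤ η → η ≤ 1 →
        ∑ n ∈ range (chainBound (hbTau ϖ X) + 1),
            |(Tpiece (classPairs X η d a b) pairIdeal X (hbTau ϖ X) n : ℝ) -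
                classWeight d / (d : ℝ) ^ 2 * (Tpiece (boxPairs X η) pairIdeal X (hbTau ϖ X) n : ℝ)| ≤
          C * hbTau ϖ X * η ^ 2 * X ^ 2 / Real.log X

open scoped Classical in
/-- **S3 — the coprime-restricted singular sum `Σ₁^{(d)}`.** For `d ≥ 1` and the limit `σ₀` of the partial
products of Heath-Brown's singular series there are `c, C > 0` with, for every `x ≥ 1`,
`|∑_{N(J) ≤ x, N(J) square-free, (N(J), d) = 1} μ(J)ρ₂(J)N(J)⁻¹log(x/N(J)) − (π²/6)σ₀·∏_{p∣d}(p+1)/(p+1−ν_p)| ≤ C e^{−c√log x}`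
— the tree's `HeathBrown2001_sigmaOne_bound` (the case `d = 1`) twisted by the FINITE Euler factor
`∏_{p∣d}(1 − ρ₀(p)p^{−s})⁻¹`, `ρ₀(p)/p = ν_p/(p+1)` (`rho₀_eq`, `densA_prime`): elementary from the `d = 1` theorem
by `1_{(n,d)=1}·a = a ∗ g_d` (`g_d` multiplicative, supported on `d`-units, `g_d(p^k) = ρ₀(p)^k`) and
`∑_m g_d(m)/m = coprimeClassWeight d`.
[cite: HeathBrownMoroz2004, Lemma 4.1 and (3.1)] [cite: HeathBrownActa2001, §10 pp. 62–63] -/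
def ClassSigmaOneCoprime : Prop :=
  ∀ d : ℕ, 0 < d → ∀ σ₀ : ℝ, Tendsto singularProductPartial atTop (𝓝 σ₀) →
    ∃ c : ℝ, 0 < c ∧ ∃ C : ℝ, 0 < C ∧ ∀ x : ℝ, 1 ≤ x →
      |(∑ J ∈ (idealsLE ⌊x⌋₊).filter
          (fun J => Squarefree (Ideal.absNorm J) ∧ Nat.Coprime d (Ideal.absNorm J)),
          idealMoebius J * Real.log (x / Ideal.absNorm J) * (rho₂ J / Ideal.absNorm J)) -
        Real.pi ^ 2 / 6 * σ₀ * coprimeClassWeight d| ≤ C * Real.exp (-c * Real.sqrt (Real.log x))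

/-- **EQ39, the differenced leading parts (PROVED below from S4b and the parent's (10.4); kept as the seam `h39` is glued at).** For every reduced admissible class and
`ϖ ∈ (0, 1/5)` there are `c, C, X₀` with, for `X ≥ X₀`, `η` in (2.1), every admissible `𝐦` ((3.5)–(3.7)) and every
`c_R` as in (3.3): `|Û_e(𝒜_cl; 𝐦, c) − (w(d)/d²)·Û_e(𝒜; 𝐦, c)| ≤ C M⁻¹ η^{5/2} X² (log X)^c` — NO `σ₀`, no `ℬ`,
no `Σ₃`: after (10.1)–(10.2) (generic `bilin_sum_divisors_eq`) and Type I on both sides (S1 / `HeathBrown2001_typeI_A_holds`),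
`c_R` is supported on `X^τ`-rough `R` (so `(N R, d) = 1` once `X^τ > d`) and the differenced main term is
`X_𝒜 ∑_R c_R ρ₂(R)N(R)⁻¹·[(ζ(2)/ζ_d(2))d⁻²·Σ₁^{(d)}(L_R) − (w/d²)·Σ₁(L_R)] = X_𝒜 ∑_R … · O_d(e^{−c√log L_R})`
by S3, the tree's `HeathBrown2001_sigmaOne_bound'` and `coprimeClassWeight_mul_zetaTwoCorrection`; the
`e^{−c√log L}` is `≤ η^{1/2}` in the range (2.1) exactly as in the tree's `HeathBrown2001_display_10_4`.
(Equivalently: the class display (10.4) with main term `(w/d²)σ₀η²X²Σ₃`, minus the tree's (10.4).)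
[cite: HeathBrownMoroz2004, Lemma 4.1] [cite: HeathBrownActa2001, Lemma 3.9 and §10 (10.1)–(10.4)] -/
def ClassLeadingDifferencing : Prop :=
  ∀ d a b : ℕ, 0 < d → a < d → b < d → Nat.Coprime (a ^ 3 + 2 * b ^ 3) d →
    ∀ ϖ : ℝ, 0 < ϖ → ϖ < 1 / 5 →
      ∃ c C X₀ : ℝ, ∀ X η : ℝ, X₀ ≤ X → Real.exp (-Real.log X ^ (1 / 3 : ℝ)) ≤ η → η ≤ 1 →
        ∀ (k : ℕ) (m : Fin k → ℕ), CoreAdmissible (hbTau ϖ X) m →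
          ∀ cR : Ideal (𝓞 K) → ℝ, CSupport X (hbTau ϖ X) cR →
            |bilin (classPairs X η d a b) pairIdeal cR (eWeight X (hbTau ϖ X) m) -
                classWeight d / (d : ℝ) ^ 2 *
                  bilin (boxPairs X η) pairIdeal cR (eWeight X (hbTau ϖ X) m)| ≤
              C * (∏ i, (m i : ℝ))⁻¹ * η ^ (5 / 2 : ℝ) * X ^ 2 * Real.log X ^ c

open scoped Classical in
/-- **S4a — class Type I summed over square-free moduli up to `B` (the class analogue of the tree's
`exists_typeI_squarefree_sum_le`, i.e. the `hTI` input of `display_10_4_core`).** For every reduced admissible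
class there are `k, C` with, for `X ≥ 4(d+2)²` (the range of the LANDED `class_typeI_A`), `η` in (2.1) and
`1 ≤ B ≤ X³`: `∑_{N(D) ≤ B, N(D) □-free} |#𝒜_{cl,D} − [(N D, d)=1]·(6η²X²/π²)(ζ(2)/ζ_d(2))d⁻²ρ₂(D)/N(D)| ≤
C·(X(1 + log X) + (B + X√B + X^{3/2})(log X)^{k+1})` — main term VERBATIM that of `class_typeI_A`. PROVED below
(`classTypeISqfreeSum_holds`): the tree's `exists_typeI_dyadic` (dyadic blocks `(Q, 2Q]`, `A = 1`, `τ(R) ≥ 1`) run on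
`class_typeI_A 1 one_pos`, plus the `D = 1` term `exists_abs_classCountA_top_sub_le` (p552423). [cite: HeathBrownMoroz2004, Lemma 2.4 and (2.29)] [cite: HeathBrownActa2001, Lemma 3.2 and §10 p. 62] -/
def ClassTypeISqfreeSum : Prop :=
  ∀ d a b : ℕ, 0 < d → a < d → b < d → Nat.Coprime (a ^ 3 + 2 * b ^ 3) d →
    ∃ (k : ℕ) (C : ℝ), 0 ≤ C ∧ ∀ X η B : ℝ, 4 * ((d : ℝ) + 2) ^ 2 ≤ X →
      Real.exp (-Real.log X ^ (1 / 3 : ℝ)) ≤ η → η ≤ 1 → 1 ≤ B → B ≤ X ^ 3 →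
        ∑ D ∈ (idealsLE ⌊B⌋₊).filter (fun D => Squarefree (Ideal.absNorm D)),
            |(classCountA X η d a b D : ℝ) -
              (if Nat.Coprime d (Ideal.absNorm D) then
                6 * η ^ 2 * X ^ 2 / Real.pi ^ 2 * zetaTwoCorrection d / (d : ℝ) ^ 2 * rho₂ D /
                  Ideal.absNorm D else 0)| ≤
          C * (X * (1 + Real.log X) + (B + X * Real.sqrt B + X ^ (3 / 2 : ℝ)) * Real.log X ^ (k + 1))

/-- **S4b conclusion — the CLASS display (10.4)** (Heath-Brown p. 64 for `𝒜_cl` in place of `𝒜`): for every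
reduced admissible class, the limit `σ₀` of the singular product and `ϖ ∈ (0, 1/5)` there are `c, C, X₀` with,
for `X ≥ X₀`, `η` in (2.1), admissible `𝐦` and `c_R` as in (3.3),
`|U_e(𝒜_cl; 𝐦, c) − (w(d)/d²)·σ₀η²X²Σ₃(𝐦, c)| ≤ C M⁻¹η^{5/2}X²(log X)^c`.
Proof plan = the tree's `display_10_4_core` / `HeathBrown2001_display_10_4` VERBATIM with two inputs swapped:
`hTI ↦ S4a` (class Type I; the indicator `[(N(RJ), d) = 1]` splits as `[(N R, d)=1]·[(N J, d)=1]`, and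
`(N R, d) = 1` automatically because `c_R` is supported on `X^τ`-rough square-free `R` (`CSupport`) and `X^τ > d`
for `X ≥ X₀(d)`), `hSig1 ↦ S3` (the `J`-sum becomes `Σ₁^{(d)}(L) = (π²/6)σ₀·coprimeClassWeight d + O(e^{−c√log L})`);
the main term is `(6η²X²/π²)(ζ(2)/ζ_d(2))d⁻² · (π²/6)σ₀·coprimeClassWeight d · Σ₃ = (w(d)/d²)σ₀η²X²Σ₃` by
`coprimeClassWeight_mul_zetaTwoCorrection`; the (10.1)–(10.2) and `ρ₂(R) = 1 + O(τ⁻¹X^{−τ})` errors are the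
parent's (`classPairs ⊆ boxPairs`, `classCountA_le_countA`). [cite: HeathBrownActa2001, §10 (10.1)–(10.4)]
[cite: HeathBrownMoroz2004, Lemma 4.1] -/
def ClassDisplay104 : Prop :=
  ∀ d a b : ℕ, 0 < d → a < d → b < d → Nat.Coprime (a ^ 3 + 2 * b ^ 3) d →
    ∀ σ₀ : ℝ, Tendsto singularProductPartial atTop (𝓝 σ₀) → ∀ ϖ : ℝ, 0 < ϖ → ϖ < 1 / 5 →
      ∃ c C X₀ : ℝ, ∀ X η : ℝ, X₀ ≤ X → Real.exp (-Real.log X ^ (1 / 3 : ℝ)) ≤ η → η ≤ 1 →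
        ∀ (k : ℕ) (m : Fin k → ℕ), CoreAdmissible (hbTau ϖ X) m →
          ∀ cR : Ideal (𝓞 K) → ℝ, CSupport X (hbTau ϖ X) cR →
            |bilin (classPairs X η d a b) pairIdeal cR (eWeight X (hbTau ϖ X) m) -
                classWeight d / (d : ℝ) ^ 2 * (σ₀ * η ^ 2 * X ^ 2 * sigma3 X (hbTau ϖ X) m cR)| ≤
              C * (∏ i, (m i : ℝ))⁻¹ * η ^ (5 / 2 : ℝ) * X ^ 2 * Real.log X ^ c

/-- **S5 — the class Type II estimate (`h310` of `heathBrownMorozUniform_of_classLemmas`, VERBATIM).**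
Heath-Brown's Lemma 3.10 for the class family with the large-sieve hypothesis (3.14) up to `d·Q₁`
(HBM04 Prop. 4.2 (ii): the class condition is one more congruence on `β̂`). Shared with line
`unit-split-positivity`; not specific to differencing. [cite: HeathBrownMoroz2004, Prop. 4.2]
[cite: HeathBrownActa2001, Lemma 3.10 and §§11–13] -/
def ClassTypeIIBound : Prop :=
  ∀ d a b : ℕ, 0 < d → a < d → b < d → Nat.Coprime (a ^ 3 + 2 * b ^ 3) d →
    ∀ ϖ : ℝ, 0 < ϖ → ϖ < 1 / 5 →
      ∃ c c₃ c₄ : ℝ, 0 < c₃ ∧ 0 < c₄ ∧ ∀ C₁ c₁ c₅ c₆ : ℝ, 0 < c₁ → 0 < c₅ → 0 < c₆ →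
        ∃ C X₀ : ℝ, ∀ X η Q₁ : ℝ, X₀ ≤ X → Real.exp (-Real.log X ^ (1 / 3 : ℝ)) ≤ η → η ≤ 1 →
          1 ≤ Q₁ → (d : ℝ) * Q₁ ≤ Real.exp (Real.log X ^ (1 / 3 : ℝ)) →
            (∀ (k' : ℕ) (m' : Fin k' → ℕ), CoreAdmissible (hbTau ϖ X) m' →
              Hyp314 X (hbTau ϖ X) m' ((d : ℝ) * Q₁) C₁ c₁ c₃ c₄) →
              ∀ (k : ℕ) (m : Fin k → ℕ), CoreAdmissible (hbTau ϖ X) m →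
                ∀ cR : Ideal (𝓞 K) → ℝ, CSupport X (hbTau ϖ X) cR →
                  ∀ V : ℝ, c₅ * X ^ (1 + hbTau ϖ X) ≤ V → V ≤ c₆ * X ^ (3 / 2 - hbTau ϖ X) →
                    |bilin (classPairs X η d a b) pairIdeal cR
                        (fun S => if V < (Ideal.absNorm S : ℝ) ∧ (Ideal.absNorm S : ℝ) ≤ 2 * V then
                          fWeight X (hbTau ϖ X) m S else 0)| ≤
                      C * X ^ 2 * Q₁ ^ (-(1 / 160 : ℝ)) * Real.log X ^ c

/-- **The direct class Lemma 3.5 (`h35` of `heathBrownMorozUniform_of_classLemmas`, VERBATIM)** — not a stub of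
this line but the ALTERNATIVE discharge of S2: ghb-prover-1 is closing it from the landed `HeathBrownMorozClassFLASide`
(`abs_TpieceClassA_sub_le`, `sum_remaindersClassA_le`, `classSizeA_mul_classProd`); `classFLDifferencing_of_h35`
below turns it into EQ35. [cite: HeathBrownMoroz2004, Lemma 3.1] [cite: HeathBrownActa2001, Lemma 3.5] -/
def ClassH35 : Prop :=
  ∀ d a b : ℕ, 0 < d → a < d → b < d → Nat.Coprime (a ^ 3 + 2 * b ^ 3) d →
    ∀ σ₀ : ℝ, Tendsto singularProductPartial atTop (𝓝 σ₀) → ∀ ϖ : ℝ, 0 < ϖ → ϖ < 1 / 5 →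
      ∃ C X₀ : ℝ, ∀ X η : ℝ, X₀ ≤ X → Real.exp (-Real.log X ^ (1 / 3 : ℝ)) ≤ η → η ≤ 1 →
        ∑ n ∈ range (chainBound (hbTau ϖ X) + 1),
            |(Tpiece (classPairs X η d a b) pairIdeal X (hbTau ϖ X) n : ℝ) -
                classKappa σ₀ X η d * Tpiece (normWindow X η) (fun J => J) X (hbTau ϖ X) n| ≤
          C * hbTau ϖ X * η ^ 2 * X ^ 2 / Real.log X

/-! ### The registered stubs of the linear-sieve half (S3, S4b; S2 closed below) -/


-- **S2 (EQ35) is NO LONGER A STUB (v4 quick win):** the direct class Lemma 3.5 LANDED as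
-- `CubicSieve.class_lemma_3_5` (p555871, ghb-prover-1, 2026-08-27T18:44Z), so `ClassH35` holds outright
-- (`classH35_holds` below) and EQ35 follows by the sibling's PROVED `classFLDifferencing_of_h35`
-- (`flDifferencing_holds` below, stated with the sibling's stub signature `ClassFLDifferencing` verbatim).

/-- **S3 CLOSED (v5)** — `Σ₁^{(d)}`: the stub-worker `ghb-stub-sigma1-p1` landed
`…Theorems.GoldbachHeathBrownDispersionHeathBrownMorozUniform.classSigmaOneCoprime` (p560964, with p559789: Perron via the
tree's `logRieszMean_LSeries_div_dedekindZeta_bound` for `a_d = a·1_{(d,·)=1}`, residue `(π²/6)σ₀γ₀·coprimeClassWeight d` by the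
finite Euler twist), whose TYPE is `ClassSigmaOneCoprime` unfolded verbatim; formerly `stub_sigmaOneCoprime`.  No longer a stub.
[cite: HeathBrownActa2001, §10 pp. 62–63] [cite: HeathBrownMoroz2004, Lemma 4.1] -/
theorem sigmaOneCoprime_holds : ClassSigmaOneCoprime :=
  classSigmaOneCoprime

/-- **S4b CLOSED (v5)** — the class display (10.4), 3-ary registered shape of v2–v4 (`stub_classDisplay104`), now a
THEOREM: the stub-worker `ghb-stub-display104-p1` landed
`…Theorems.GoldbachHeathBrownDispersionHeathBrownMorozUniform.classDisplay104_of_typeISqfreeSum_of_sigmaOneCoprime` (p562472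
`…ClassDisplay104.lean`, over `…ClassDisplay104Pairs` p557644, `…Sums` p559714, `…Core` p561076, `…ClassPairsTypeI` p561315: the
class re-run of `HeathBrownCubicLeadingA(Pairs)` (10.1)–(10.2) and the class twin `classDisplay104_core` of `display_10_4_core`,
main-term constant `coprimeClassWeight_mul_zetaTwoCorrection`, `[(N R, d) = 1]` for `X^τ`-rough `R`), whose TYPE is this
statement unfolded verbatim.  No longer a stub.
[cite: HeathBrownActa2001, §10 (10.1)–(10.4)] [cite: HeathBrownMoroz2004, Lemma 4.1] -/
theorem classDisplay104_of_hyps : ClassTypeISqfreeSum → ClassSigmaOneCoprime → ClassDisplay104 :=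
  classDisplay104_of_typeISqfreeSum_of_sigmaOneCoprime

/-! ### S4a PROVED (quick win): class Type I summed dyadically over square-free moduli -/

open scoped Classical in
/-- **Class Lemma 3.2 summed dyadically** (the class twin of `exists_typeI_dyadic`): from the landed
`class_typeI_A` (with `A = 1`) there are `k, C` — uniform in the class — such that for every reduced admissible
class `(a, b) mod d`, `X ≥ 4(d+2)²`, `η` in the range (2.1) and `1 ≤ B ≤ X³`,
`∑_{2 ≤ N(R) ≤ B, N(R) □-free} |#𝒜_{cl,R} − main_R| ≤ C (B + X√B + X^{3/2}) (log X)^{k+1}` (at most `7 log X` blocks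
`(2^j, 2^{j+1}]`, each bounded by `class_typeI_A` with `(log(2^jX))^c ≤ (5 log X)^k`, `τ(R) ≥ 1`).
[cite: HeathBrownMoroz2004, Lemma 2.4 (2.29)] [cite: HeathBrownActa2001, Lemma 3.2 and §7 p. 40] -/
theorem class_typeI_dyadic :
    ∃ (k : ℕ) (C : ℝ), 0 ≤ C ∧ ∀ d a b : ℕ, 0 < d → a < d → b < d → Nat.Coprime (a ^ 3 + 2 * b ^ 3) d →
      ∀ X η B : ℝ, 4 * ((d : ℝ) + 2) ^ 2 ≤ X →
      Real.exp (-Real.log X ^ (1 / 3 : ℝ)) ≤ η → η ≤ 1 → 1 ≤ B → B ≤ X ^ 3 →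
      ∑ R ∈ (idealsLE ⌊B⌋₊).filter (fun R => 2 ≤ Ideal.absNorm R ∧ Squarefree (Ideal.absNorm R)),
          |(classCountA X η d a b R : ℝ) -
              (if Nat.Coprime d (Ideal.absNorm R) then
                6 * η ^ 2 * X ^ 2 / Real.pi ^ 2 * zetaTwoCorrection d / (d : ℝ) ^ 2 * rho₂ R /
                  Ideal.absNorm R else 0)| ≤
        C * (B + X * Real.sqrt B + X ^ (3 / 2 : ℝ)) * Real.log X ^ (k + 1) := by
  classical
  obtain ⟨c, C, -, -, hC⟩ := class_typeI_A 1 one_pos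
  set k : ℕ := ⌈max c 0⌉₊ with hk
  refine ⟨k, 14 * 5 ^ k * max C 0, by positivity,
    fun d a b hd ha hb hadm X η B hX hηlo hη1 hB1 hBX => ?_⟩
  set 𝓡 := (idealsLE ⌊B⌋₊).filter (fun R => 2 ≤ Ideal.absNorm R ∧ Squarefree (Ideal.absNorm R))
    with h𝓡
  set J : ℕ := ⌊Real.log (B + 1) / Real.log 2⌋₊ with hJ
  have hd1 : (1 : ℝ) ≤ d := by exact_mod_cast hd
  have hX3 : 3 ≤ X := by nlinarith
  have hX2 : 2 ≤ X := by linarith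
  have hX0 : 0 < X := by linarith
  have hX1 : 1 ≤ X := by linarith
  have hηpos : 0 < η := (Real.exp_pos _).trans_le hηlo
  have hl2 : 0 < Real.log 2 := Real.log_pos one_lt_two
  have hlogX1 : 1 ≤ Real.log X := by
    rw [← Real.log_exp 1]
    refine Real.log_le_log (Real.exp_pos 1) ?_
    have := Real.exp_one_lt_d9
    linarith
  have hlogX0 : 0 < Real.log X := by linarith
  have hB0 : 0 < B := by linarith
  set E : Ideal (𝓞 K) → ℝ := fun R => |(classCountA X η d a b R : ℝ) -
      (if Nat.Coprime d (Ideal.absNorm R) then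
        6 * η ^ 2 * X ^ 2 / Real.pi ^ 2 * zetaTwoCorrection d / (d : ℝ) ^ 2 * rho₂ R /
          Ideal.absNorm R else 0)| with hE
  have hE0 : ∀ R, 0 ≤ E R := fun R => abs_nonneg _
  -- every `R` lies in a block `j ≤ J`
  have hmaps : ∀ R ∈ 𝓡, dyadIdx (Ideal.absNorm R) ∈ range (J + 1) := by
    intro R hR
    rw [h𝓡, mem_filter, mem_idealsLE] at hR
    obtain ⟨hRB, h2, -⟩ := hR
    rw [mem_range, Nat.lt_succ_iff, hJ]
    refine Nat.le_floor (dyadIdx_le_log h2 ?_)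
    have : (Ideal.absNorm R : ℝ) ≤ ⌊B⌋₊ := by exact_mod_cast hRB
    linarith [Nat.floor_le hB0.le]
  rw [← sum_fiberwise_of_maps_to hmaps]
  -- the bound for one block
  have h2J : (2 : ℝ) ^ J ≤ B + 1 := two_pow_floor_log_le (by linarith)
  have hblock : ∀ j ∈ range (J + 1),
      ∑ R ∈ 𝓡.filter (fun R => dyadIdx (Ideal.absNorm R) = j), E R ≤
        max C 0 * (2 * (B + X * Real.sqrt B + X ^ (3 / 2 : ℝ))) * (5 * Real.log X) ^ k := by
    intro j hj
    rw [mem_range, Nat.lt_succ_iff] at hj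
    set Q' : ℝ := (2 : ℝ) ^ j with hQ'
    have hQ'1 : 1 ≤ Q' := one_le_pow₀ one_le_two
    have hQ'B : Q' ≤ B + 1 := (pow_le_pow_right₀ one_le_two hj).trans h2J
    have h := hC d a b hd ha hb hadm X η Q' hX hηpos hη1 hQ'1
    have hsub : 𝓡.filter (fun R => dyadIdx (Ideal.absNorm R) = j) ⊆
        (idealsLE ⌊2 * Q'⌋₊).filter (fun R => Q' < (Ideal.absNorm R : ℝ) ∧
          (Ideal.absNorm R : ℝ) ≤ 2 * Q' ∧ Squarefree (Ideal.absNorm R)) := by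
      intro R hR
      rw [mem_filter, h𝓡, mem_filter, mem_idealsLE] at hR
      obtain ⟨⟨-, h2, hsq⟩, hjR⟩ := hR
      have hlt := pow_dyadIdx_lt h2
      have hle := le_pow_dyadIdx_succ (Ideal.absNorm R)
      rw [hjR] at hlt hle
      have hfloor : ⌊2 * Q'⌋₊ = 2 ^ (j + 1) := by
        rw [hQ', show (2 : ℝ) * 2 ^ j = ((2 ^ (j + 1) : ℕ) : ℝ) by push_cast; ring, Nat.floor_natCast]
      rw [mem_filter, mem_idealsLE, hfloor]
      refine ⟨hle, ?_, ?_, hsq⟩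
      · rw [hQ']; exact_mod_cast hlt
      · have : ((Ideal.absNorm R : ℕ) : ℝ) ≤ ((2 ^ (j + 1) : ℕ) : ℝ) := by exact_mod_cast hle
        rw [hQ']
        push_cast at this
        rw [pow_succ] at this
        linarith
    have hpt : ∀ R ∈ 𝓡.filter (fun R => dyadIdx (Ideal.absNorm R) = j), E R ≤
        (idealDivisorCount R : ℝ) ^ 1 * E R := by
      intro R hR
      rw [mem_filter, h𝓡, mem_filter] at hR
      have hR0 : R ≠ ⊥ := fun h0 => by
        have := hR.1.2.1; rw [h0, Ideal.absNorm_bot] at this; omega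
      have hτ : (1 : ℝ) ≤ (idealDivisorCount R : ℝ) ^ 1 := by
        rw [pow_one]; exact_mod_cast one_le_idealDivisorCount hR0
      exact le_mul_of_one_le_left (hE0 R) hτ
    have hnn : ∀ R ∈ (idealsLE ⌊2 * Q'⌋₊).filter (fun R => Q' < (Ideal.absNorm R : ℝ) ∧
          (Ideal.absNorm R : ℝ) ≤ 2 * Q' ∧ Squarefree (Ideal.absNorm R)),
        0 ≤ (idealDivisorCount R : ℝ) ^ 1 * E R :=
      fun R _ => mul_nonneg (by positivity) (hE0 R)
    -- the logarithm: `log(Q'X)^c ≤ (5 log X)^k`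
    have hQX1 : 1 ≤ Real.log (Q' * X) := by
      calc (1 : ℝ) ≤ Real.log X := hlogX1
        _ ≤ Real.log (Q' * X) := Real.log_le_log hX0 (le_mul_of_one_le_left hX0.le hQ'1)
    have hlogQX : Real.log (Q' * X) ≤ 5 * Real.log X := by
      have hQ'X : Q' * X ≤ X ^ 5 := by
        have hB2 : B + 1 ≤ 2 * X ^ 3 := by nlinarith [one_le_pow₀ (n := 3) hX1]
        calc Q' * X ≤ (2 * X ^ 3) * X := by gcongr; linarith
          _ = 2 * X ^ 4 := by ring
          _ ≤ X * X ^ 4 := by gcongr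
          _ = X ^ 5 := by ring
      calc Real.log (Q' * X) ≤ Real.log (X ^ 5) := Real.log_le_log (by positivity) hQ'X
        _ = 5 * Real.log X := by rw [Real.log_pow]; push_cast; ring
    have hck : c ≤ (k : ℝ) := (le_max_left c 0).trans (Nat.le_ceil _)
    have hlogpow : Real.log (Q' * X) ^ c ≤ (5 * Real.log X) ^ k := by
      calc Real.log (Q' * X) ^ c ≤ Real.log (Q' * X) ^ (k : ℝ) :=
            Real.rpow_le_rpow_of_exponent_le hQX1 hck
        _ = Real.log (Q' * X) ^ k := Real.rpow_natCast _ _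
        _ ≤ (5 * Real.log X) ^ k := pow_le_pow_left₀ (by linarith) hlogQX k
    have hgeom : Q' + X * Real.sqrt Q' + X ^ (3 / 2 : ℝ) ≤ 2 * (B + X * Real.sqrt B + X ^ (3 / 2 : ℝ)) := by
      have hs : Real.sqrt Q' ≤ 2 * Real.sqrt B := by
        calc Real.sqrt Q' ≤ Real.sqrt (4 * B) := Real.sqrt_le_sqrt (by linarith)
          _ = 2 * Real.sqrt B := by
              rw [Real.sqrt_mul (by norm_num), show (4 : ℝ) = 2 ^ 2 by norm_num,
                Real.sqrt_sq (by norm_num)]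
      have hX32 : 0 ≤ X ^ (3 / 2 : ℝ) := by positivity
      nlinarith [mul_le_mul_of_nonneg_left hs hX0.le, Real.sqrt_nonneg B]
    calc ∑ R ∈ 𝓡.filter (fun R => dyadIdx (Ideal.absNorm R) = j), E R
        ≤ ∑ R ∈ 𝓡.filter (fun R => dyadIdx (Ideal.absNorm R) = j), (idealDivisorCount R : ℝ) ^ 1 * E R :=
          sum_le_sum hpt
      _ ≤ ∑ R ∈ (idealsLE ⌊2 * Q'⌋₊).filter (fun R => Q' < (Ideal.absNorm R : ℝ) ∧
            (Ideal.absNorm R : ℝ) ≤ 2 * Q' ∧ Squarefree (Ideal.absNorm R)),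
            (idealDivisorCount R : ℝ) ^ 1 * E R :=
          sum_le_sum_of_subset_of_nonneg hsub fun R hR _ => hnn R hR
      _ ≤ C * (Q' + X * Real.sqrt Q' + X ^ (3 / 2 : ℝ)) * Real.log (Q' * X) ^ c := h
      _ ≤ max C 0 * (Q' + X * Real.sqrt Q' + X ^ (3 / 2 : ℝ)) * Real.log (Q' * X) ^ c :=
          mul_le_mul_of_nonneg_right (mul_le_mul_of_nonneg_right (le_max_left _ _) (by positivity))
            (Real.rpow_nonneg (by linarith) _)
      _ ≤ max C 0 * (2 * (B + X * Real.sqrt B + X ^ (3 / 2 : ℝ))) * (5 * Real.log X) ^ k := by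
          gcongr
  -- the number of blocks
  have hJle : ((J + 1 : ℕ) : ℝ) ≤ 7 * Real.log X := by
    have h1 : (J : ℝ) ≤ Real.log (B + 1) / Real.log 2 :=
      Nat.floor_le (div_nonneg (Real.log_nonneg (by linarith)) hl2.le)
    have h2 : Real.log (B + 1) ≤ 4 * Real.log X := by
      have hB2 : B + 1 ≤ X ^ 4 := by nlinarith [one_le_pow₀ (n := 3) hX1]
      calc Real.log (B + 1) ≤ Real.log (X ^ 4) := Real.log_le_log (by linarith) hB2
        _ = 4 * Real.log X := by rw [Real.log_pow]; push_cast; ring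
    have h3 : Real.log (B + 1) / Real.log 2 ≤ 6 * Real.log X := by
      rw [div_le_iff₀ hl2]
      have h69 := Real.log_two_gt_d9
      have : 0.6931471803 * (6 * Real.log X) ≤ Real.log 2 * (6 * Real.log X) :=
        mul_le_mul_of_nonneg_right h69.le (by positivity)
      nlinarith
    push_cast
    linarith
  calc ∑ j ∈ range (J + 1), ∑ R ∈ 𝓡.filter (fun R => dyadIdx (Ideal.absNorm R) = j), E R
      ≤ ∑ j ∈ range (J + 1),
          max C 0 * (2 * (B + X * Real.sqrt B + X ^ (3 / 2 : ℝ))) * (5 * Real.log X) ^ k :=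
        sum_le_sum hblock
    _ = ((J + 1 : ℕ) : ℝ) *
          (max C 0 * (2 * (B + X * Real.sqrt B + X ^ (3 / 2 : ℝ))) * (5 * Real.log X) ^ k) := by
        rw [sum_const, card_range, nsmul_eq_mul]
    _ ≤ (7 * Real.log X) *
          (max C 0 * (2 * (B + X * Real.sqrt B + X ^ (3 / 2 : ℝ))) * (5 * Real.log X) ^ k) :=
        mul_le_mul_of_nonneg_right hJle
          (mul_nonneg (mul_nonneg (le_max_right C 0) (by positivity)) (pow_nonneg (by linarith) k))
    _ = 14 * 5 ^ k * max C 0 * (B + X * Real.sqrt B + X ^ (3 / 2 : ℝ)) * Real.log X ^ (k + 1) := by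
        rw [mul_pow, pow_succ]; ring

open scoped Classical in
/-- **S4a PROVED — class Type I summed over all square-free moduli up to `B`** (the class twin of
`exists_typeI_squarefree_sum_le`): `class_typeI_dyadic` for `N(D) ≥ 2` plus the `D = (1)` term
`exists_abs_classCountA_top_sub_le` (`ρ₂(1) = 1`, `(1, d) = 1`). [cite: HeathBrownMoroz2004, Lemma 2.4 (2.29)]
[cite: HeathBrownActa2001, Lemma 3.2 and §10 p. 62] -/
theorem classTypeISqfreeSum_holds : ClassTypeISqfreeSum := by
  classical
  intro d a b hd ha hb hadm
  obtain ⟨k, C₂, hC₂, h₂⟩ := class_typeI_dyadic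
  obtain ⟨C₁, hC₁, h₁⟩ := exists_abs_classCountA_top_sub_le (a := a) (b := b) hd hadm
  refine ⟨k, max C₁ C₂, le_max_of_le_left hC₁.le, fun X η B hX hηlo hη1 hB1 hBX => ?_⟩
  have hη0 : 0 ≤ η := le_trans (Real.exp_pos _).le hηlo
  have hd1 : (1 : ℝ) ≤ d := by exact_mod_cast hd
  have hX2 : 2 ≤ X := by nlinarith
  set S := (idealsLE ⌊B⌋₊).filter (fun D => Squarefree (Ideal.absNorm D)) with hS
  set f : Ideal (𝓞 K) → ℝ := fun D => |(classCountA X η d a b D : ℝ) -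
      (if Nat.Coprime d (Ideal.absNorm D) then
        6 * η ^ 2 * X ^ 2 / Real.pi ^ 2 * zetaTwoCorrection d / (d : ℝ) ^ 2 * rho₂ D /
          Ideal.absNorm D else 0)| with hf
  rw [← Finset.sum_filter_add_sum_filter_not S (fun D => 2 ≤ Ideal.absNorm D)]
  -- the part `N(D) ≥ 2`
  have hbig : ∑ D ∈ S.filter (fun D => 2 ≤ Ideal.absNorm D), f D ≤
      C₂ * (B + X * Real.sqrt B + X ^ (3 / 2 : ℝ)) * Real.log X ^ (k + 1) := by
    have hset : S.filter (fun D => 2 ≤ Ideal.absNorm D) =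
        (idealsLE ⌊B⌋₊).filter (fun R => 2 ≤ Ideal.absNorm R ∧ Squarefree (Ideal.absNorm R)) := by
      rw [hS, Finset.filter_filter]
      exact Finset.filter_congr fun D _ => and_comm
    rw [hset]
    exact h₂ d a b hd ha hb hadm X η B hX hηlo hη1 hB1 hBX
  -- the part `N(D) < 2`, i.e. `D = (1)`
  have hρ : rho₂ (⊤ : Ideal (𝓞 K)) = 1 := by
    rw [rho₂_eq_of_squarefree (by rw [Ideal.absNorm_top]; exact squarefree_one), Ideal.absNorm_top,
      Nat.primeFactors_one, prod_empty]
  have hsmall : ∑ D ∈ S.filter (fun D => ¬2 ≤ Ideal.absNorm D), f D ≤ C₁ * X * (1 + Real.log X) := by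
    have hsub : S.filter (fun D => ¬2 ≤ Ideal.absNorm D) ⊆ {⊤} := by
      intro D hD
      rw [mem_filter, hS, mem_filter] at hD
      rw [Finset.mem_singleton]
      have h0 : Ideal.absNorm D ≠ 0 := Squarefree.ne_zero hD.1.2
      have h1 : Ideal.absNorm D = 1 := by omega
      exact Ideal.absNorm_eq_one_iff.mp h1
    calc ∑ D ∈ S.filter (fun D => ¬2 ≤ Ideal.absNorm D), f D ≤ ∑ D ∈ ({⊤} : Finset (Ideal (𝓞 K))), f D :=
          Finset.sum_le_sum_of_subset_of_nonneg hsub fun D _ _ => abs_nonneg _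
      _ = |(classCountA X η d a b ⊤ : ℝ) -
            6 * η ^ 2 * X ^ 2 / Real.pi ^ 2 * zetaTwoCorrection d / (d : ℝ) ^ 2| := by
          rw [Finset.sum_singleton, hf]
          simp only
          rw [Ideal.absNorm_top, if_pos (Nat.coprime_one_right _), hρ, Nat.cast_one, mul_one, div_one]
      _ ≤ C₁ * X * (1 + Real.log X) := h₁ X η hX2 hη0 hη1
  have hlog : 0 ≤ Real.log X := Real.log_nonneg (by linarith)
  have hT1 : 0 ≤ X * (1 + Real.log X) := by nlinarith
  have hT2 : 0 ≤ (B + X * Real.sqrt B + X ^ (3 / 2 : ℝ)) * Real.log X ^ (k + 1) := by positivity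
  calc ∑ D ∈ S.filter (fun D => 2 ≤ Ideal.absNorm D), f D +
        ∑ D ∈ S.filter (fun D => ¬2 ≤ Ideal.absNorm D), f D
      ≤ C₂ * (B + X * Real.sqrt B + X ^ (3 / 2 : ℝ)) * Real.log X ^ (k + 1) + C₁ * X * (1 + Real.log X) :=
        add_le_add hbig hsmall
    _ ≤ max C₁ C₂ * ((B + X * Real.sqrt B + X ^ (3 / 2 : ℝ)) * Real.log X ^ (k + 1)) +
        max C₁ C₂ * (X * (1 + Real.log X)) := by
        rw [mul_assoc, mul_assoc]
        exact add_le_add (mul_le_mul_of_nonneg_right (le_max_right _ _) hT2)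
          (mul_le_mul_of_nonneg_right (le_max_left _ _) hT1)
    _ = max C₁ C₂ * (X * (1 + Real.log X) + (B + X * Real.sqrt B + X ^ (3 / 2 : ℝ)) * Real.log X ^ (k + 1)) := by
        ring

/-! ### Falsifier certificates (PROVED): the normalisations of S4b and S3 are the right ones -/

/-- **Cheapest falsifier of S4b's constant, RUN: the class main-term constant IS `(w(d)/d²)σ₀`.**
`X_cl · (π²/6)σ₀·coprimeClassWeight d = (w(d)/d²)·σ₀η²X²` with `X_cl = (6η²X²/π²)(ζ(2)/ζ_d(2))d⁻²`
(`coprimeClassWeight_mul_zetaTwoCorrection`). [cite: HeathBrownMoroz2004, §3 (3.1)] -/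
theorem classDisplay104_mainConst (d : ℕ) (σ₀ η X S : ℝ) :
    6 * η ^ 2 * X ^ 2 / Real.pi ^ 2 * zetaTwoCorrection d / (d : ℝ) ^ 2 *
        (Real.pi ^ 2 / 6 * σ₀ * coprimeClassWeight d) * S =
      classWeight d / (d : ℝ) ^ 2 * (σ₀ * η ^ 2 * X ^ 2 * S) := by
  rw [← coprimeClassWeight_mul_zetaTwoCorrection]
  have hπ : Real.pi ^ 2 ≠ 0 := pow_ne_zero 2 Real.pi_ne_zero
  rw [div_eq_mul_inv _ (Real.pi ^ 2)]
  have : Real.pi ^ 2 * (Real.pi ^ 2)⁻¹ = 1 := mul_inv_cancel₀ hπ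
  calc 6 * η ^ 2 * X ^ 2 * (Real.pi ^ 2)⁻¹ * zetaTwoCorrection d / (d : ℝ) ^ 2 *
          (Real.pi ^ 2 / 6 * σ₀ * coprimeClassWeight d) * S
        = (Real.pi ^ 2 * (Real.pi ^ 2)⁻¹) * (coprimeClassWeight d * zetaTwoCorrection d / (d : ℝ) ^ 2 *
            (σ₀ * η ^ 2 * X ^ 2 * S)) := by ring
    _ = _ := by rw [this, one_mul]

open scoped Classical in
/-- **Cheapest falsifier of S3's normalisation, RUN: at `d = 1` the statement IS the tree's `Σ₁` theorem**
(`coprimeClassWeight 1 = 1`, the coprimality condition is vacuous). [cite: HeathBrownActa2001, §10 p. 63] -/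
theorem classSigmaOneCoprime_one (σ₀ : ℝ) (hσ : Tendsto singularProductPartial atTop (𝓝 σ₀)) :
    ∃ c : ℝ, 0 < c ∧ ∃ C : ℝ, 0 < C ∧ ∀ x : ℝ, 1 ≤ x →
      |(∑ J ∈ (idealsLE ⌊x⌋₊).filter
          (fun J => Squarefree (Ideal.absNorm J) ∧ Nat.Coprime 1 (Ideal.absNorm J)),
          idealMoebius J * Real.log (x / Ideal.absNorm J) * (rho₂ J / Ideal.absNorm J)) -
        Real.pi ^ 2 / 6 * σ₀ * coprimeClassWeight 1| ≤ C * Real.exp (-c * Real.sqrt (Real.log x)) := by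
  obtain ⟨c, hc, C, hC, h⟩ := HeathBrown2001_sigmaOne_bound hσ
  refine ⟨c, hc, C, hC, fun x hx => ?_⟩
  have hw : coprimeClassWeight 1 = 1 := by
    rw [coprimeClassWeight, Nat.primeFactors_one, prod_empty]
  have hfilter : (idealsLE ⌊x⌋₊).filter
      (fun J => Squarefree (Ideal.absNorm J) ∧ Nat.Coprime 1 (Ideal.absNorm J)) =
      (idealsLE ⌊x⌋₊).filter (fun J => Squarefree (Ideal.absNorm J)) :=
    filter_congr fun J _ => by simp
  rw [hw, mul_one, hfilter]
  exact h x hx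

/-! ### Glue (PROVED): the class lemmas `h35`, `h39` from the differenced statements and the parent lemmas -/

/-- The triangle inequality through the scaled parent: `|A − wκB| ≤ |A − wP| + w|P − κB|` for `w ≥ 0`.
[folklore] -/
theorem abs_sub_le_of_mid {A P B w κ : ℝ} (hw : 0 ≤ w) :
    |A - w * κ * B| ≤ |A - w * P| + w * |P - κ * B| := by
  have h := abs_sub_le A (w * P) (w * κ * B)
  have e : w * P - w * κ * B = w * (P - κ * B) := by ring
  rw [e, abs_mul, abs_of_nonneg hw] at h
  exact h

/-- `|A − wB| ≤ |A − wP| + w|P − B|` for `w ≥ 0` (class (10.4) vs the scaled parent (10.4)). [folklore] -/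
theorem abs_sub_le_of_mid₁ {A P B w : ℝ} (hw : 0 ≤ w) :
    |A - w * B| ≤ |A - w * P| + w * |P - B| := by
  have h := abs_sub_le A (w * P) (w * B)
  have e : w * P - w * B = w * (P - B) := by ring
  rw [e, abs_mul, abs_of_nonneg hw] at h
  exact h

/-- `|A − wP| ≤ |A − wκB| + w|P − κB|` for `w ≥ 0` (EQ35 from the direct class Lemma 3.5 and the parent's).
[folklore] -/
theorem abs_sub_le_of_mid₂ {A P B w κ : ℝ} (hw : 0 ≤ w) :
    |A - w * P| ≤ |A - w * κ * B| + w * |P - κ * B| := by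
  have h := abs_sub_le A (w * κ * B) (w * P)
  have e : w * κ * B - w * P = w * (κ * B - P) := by ring
  rw [e, abs_mul, abs_of_nonneg hw, abs_sub_comm (κ * B) P] at h
  exact h

/-- Merging two power-of-log bounds: `C·F·L^c ≤ |C|·F·L^{c'}` for `F ≥ 0`, `L ≥ 1`, `c ≤ c'`
(`F = M⁻¹η^{5/2}X²` written as three factors). [folklore] -/
theorem const_rpow_mono {C M E X2 L c c' : ℝ} (hM : 0 ≤ M) (hE : 0 ≤ E) (hX : 0 ≤ X2) (hL : 1 ≤ L)
    (hc : c ≤ c') : C * M * E * X2 * L ^ c ≤ |C| * M * E * X2 * L ^ c' := by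
  have h1 : 0 ≤ L ^ c := Real.rpow_nonneg (by linarith) _
  have h2 : L ^ c ≤ L ^ c' := Real.rpow_le_rpow_of_exponent_le hL hc
  have hF : 0 ≤ M * E * X2 := mul_nonneg (mul_nonneg hM hE) hX
  have e1 : C * M * E * X2 * L ^ c = C * (M * E * X2) * L ^ c := by ring
  have e2 : |C| * M * E * X2 * L ^ c' = |C| * (M * E * X2) * L ^ c' := by ring
  rw [e1, e2]
  calc C * (M * E * X2) * L ^ c ≤ |C| * (M * E * X2) * L ^ c :=
        mul_le_mul_of_nonneg_right (mul_le_mul_of_nonneg_right (le_abs_self C) hF) h1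
    _ ≤ |C| * (M * E * X2) * L ^ c' := mul_le_mul_of_nonneg_left h2 (mul_nonneg (abs_nonneg C) hF)

/-- `w(d)/d² ≥ 0`. [cite: HeathBrownMoroz2004, (3.1)] -/
theorem classWeight_div_sq_nonneg (d : ℕ) : 0 ≤ classWeight d / (d : ℝ) ^ 2 :=
  div_nonneg (classWeight_pos d).le (pow_nonneg (Nat.cast_nonneg d) 2)

/-- **`h35` from EQ35 and the parent's Lemma 3.5 (tree: `HeathBrown2001_lemma_3_5_holds`).**
`T⁽ⁿ⁾(𝒜_cl) − κ_d T⁽ⁿ⁾(ℬ) = [T⁽ⁿ⁾(𝒜_cl) − (w/d²)T⁽ⁿ⁾(𝒜)] + (w/d²)[T⁽ⁿ⁾(𝒜) − κT⁽ⁿ⁾(ℬ)]`, `κ_d = (w/d²)κ`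
(`classKappa_def`); constants `C₁ + (w/d²)C₂`, `X₀ = max`. [cite: HeathBrownMoroz2004, Lemma 3.1]
[cite: HeathBrownActa2001, Lemma 3.5] -/
theorem h35_of_flDifferencing (hFL : ClassFLDifferencing) :
    ∀ d a b : ℕ, 0 < d → a < d → b < d → Nat.Coprime (a ^ 3 + 2 * b ^ 3) d →
      ∀ σ₀ : ℝ, Tendsto singularProductPartial atTop (𝓝 σ₀) → ∀ ϖ : ℝ, 0 < ϖ → ϖ < 1 / 5 →
        ∃ C X₀ : ℝ, ∀ X η : ℝ, X₀ ≤ X → Real.exp (-Real.log X ^ (1 / 3 : ℝ)) ≤ η → η ≤ 1 →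
          ∑ n ∈ range (chainBound (hbTau ϖ X) + 1),
              |(Tpiece (classPairs X η d a b) pairIdeal X (hbTau ϖ X) n : ℝ) -
                  classKappa σ₀ X η d * Tpiece (normWindow X η) (fun J => J) X (hbTau ϖ X) n| ≤
            C * hbTau ϖ X * η ^ 2 * X ^ 2 / Real.log X := by
  intro d a b hd ha hb hadm σ₀ hσ ϖ hϖ0 hϖ5
  obtain ⟨C₁, X₁, h₁⟩ := hFL d a b hd ha hb hadm ϖ hϖ0 hϖ5
  obtain ⟨C₂, X₂, h₂⟩ := HeathBrown2001_lemma_3_5_holds σ₀ hσ ϖ hϖ0 hϖ5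
  have hw := classWeight_div_sq_nonneg d
  refine ⟨C₁ + classWeight d / (d : ℝ) ^ 2 * C₂, max X₁ X₂, fun X η hX hη hη1 => ?_⟩
  have e₁ := h₁ X η ((le_max_left _ _).trans hX) hη hη1
  have e₂ := h₂ X η ((le_max_right _ _).trans hX) hη hη1
  simp only [classKappa_def]
  refine (sum_le_sum fun n _ => abs_sub_le_of_mid
    (P := (Tpiece (boxPairs X η) pairIdeal X (hbTau ϖ X) n : ℝ)) hw).trans ?_
  rw [sum_add_distrib, ← mul_sum]
  refine (add_le_add e₁ (mul_le_mul_of_nonneg_left e₂ hw)).trans_eq ?_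
  ring

/-- **EQ35 from the direct class Lemma 3.5 and the parent's** (the alternative discharge of S2):
`T⁽ⁿ⁾(𝒜_cl) − (w/d²)T⁽ⁿ⁾(𝒜) = [T⁽ⁿ⁾(𝒜_cl) − κ_dT⁽ⁿ⁾(ℬ)] − (w/d²)[T⁽ⁿ⁾(𝒜) − κT⁽ⁿ⁾(ℬ)]` with `σ₀` supplied by the
tree's `HeathBrown2001_singularProduct_holds`. [cite: HeathBrownMoroz2004, Lemma 3.1] [cite: HeathBrownActa2001, Lemma 3.5] -/
theorem classFLDifferencing_of_h35 (h : ClassH35) : ClassFLDifferencing := by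
  intro d a b hd ha hb hadm ϖ hϖ0 hϖ5
  obtain ⟨σ₀, -, hσ⟩ := HeathBrown2001_singularProduct_holds
  obtain ⟨C₁, X₁, h₁⟩ := h d a b hd ha hb hadm σ₀ hσ ϖ hϖ0 hϖ5
  obtain ⟨C₂, X₂, h₂⟩ := HeathBrown2001_lemma_3_5_holds σ₀ hσ ϖ hϖ0 hϖ5
  have hw := classWeight_div_sq_nonneg d
  refine ⟨C₁ + classWeight d / (d : ℝ) ^ 2 * C₂, max X₁ X₂, fun X η hX hη hη1 => ?_⟩
  have e₁ := h₁ X η ((le_max_left _ _).trans hX) hη hη1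
  have e₂ := h₂ X η ((le_max_right _ _).trans hX) hη hη1
  simp only [classKappa_def] at e₁
  refine (sum_le_sum fun n _ => abs_sub_le_of_mid₂
    (κ := kappa σ₀ X η) (B := (Tpiece (normWindow X η) (fun J => J) X (hbTau ϖ X) n : ℝ)) hw).trans ?_
  rw [sum_add_distrib, ← mul_sum]
  refine (add_le_add e₁ (mul_le_mul_of_nonneg_left e₂ hw)).trans_eq ?_
  ring

/-- **EQ39 from the class display (10.4) (S4b) and the parent's display (10.4)** (tree:
`HeathBrown2001_display_10_4`): `Û_e(𝒜_cl) − (w/d²)Û_e(𝒜) = [Û_e(𝒜_cl) − (w/d²)σ₀η²X²Σ₃] − (w/d²)[Û_e(𝒜) − σ₀η²X²Σ₃]`,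
`σ₀` from `HeathBrown2001_singularProduct_holds`; exponents merged to `max c₁ c₂` (`log X ≥ 1` for `X ≥ e`),
constants `|C₁| + (w/d²)|C₂|`. [cite: HeathBrownActa2001, §10 (10.4)] [cite: HeathBrownMoroz2004, Lemma 4.1] -/
theorem classLeadingDifferencing_of_display104 (hD : ClassDisplay104) : ClassLeadingDifferencing := by
  intro d a b hd ha hb hadm ϖ hϖ0 hϖ5
  obtain ⟨σ₀, -, hσ⟩ := HeathBrown2001_singularProduct_holds
  obtain ⟨c₁, C₁, X₁, h₁⟩ := hD d a b hd ha hb hadm σ₀ hσ ϖ hϖ0 hϖ5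
  obtain ⟨c₂, C₂, X₂, h₂⟩ := HeathBrown2001_display_10_4 σ₀ hσ ϖ hϖ0 hϖ5
  have hw := classWeight_div_sq_nonneg d
  refine ⟨max c₁ c₂, |C₁| + classWeight d / (d : ℝ) ^ 2 * |C₂|, max (max X₁ X₂) (Real.exp 1), ?_⟩
  intro X η hX hη hη1 k m hm cR hcR
  have hX1 : X₁ ≤ X := (le_max_left _ _).trans ((le_max_left _ _).trans hX)
  have hX2 : X₂ ≤ X := (le_max_right _ _).trans ((le_max_left _ _).trans hX)
  have hXe : Real.exp 1 ≤ X := (le_max_right _ _).trans hX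
  have hlog : 1 ≤ Real.log X := by
    have h := Real.log_le_log (Real.exp_pos 1) hXe
    rwa [Real.log_exp] at h
  have hη0 : 0 ≤ η := (Real.exp_pos _).le.trans hη
  have hM : 0 ≤ (∏ i, (m i : ℝ))⁻¹ := inv_nonneg.2 (prod_nonneg fun i _ => Nat.cast_nonneg _)
  have hE : 0 ≤ η ^ (5 / 2 : ℝ) := Real.rpow_nonneg hη0 _
  have hX2' : 0 ≤ X ^ 2 := sq_nonneg X
  have e₁ := h₁ X η hX1 hη hη1 k m hm cR hcR
  have e₂ := h₂ X η hX2 hη hη1 k m hm cR hcR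
  rw [abs_sub_comm] at e₂
  refine (abs_sub_le_of_mid₁
    (P := σ₀ * η ^ 2 * X ^ 2 * sigma3 X (hbTau ϖ X) m cR) hw).trans ?_
  refine (add_le_add (e₁.trans (const_rpow_mono hM hE hX2' hlog (le_max_left c₁ c₂)))
    (mul_le_mul_of_nonneg_left (e₂.trans (const_rpow_mono hM hE hX2' hlog (le_max_right c₁ c₂)))
      hw)).trans_eq ?_
  ring

/-- **`h39` from EQ39 and the parent's Lemma 3.9 (tree: `HeathBrown2001_lemma_3_9_holds`).**
`Û_e(𝒜_cl) − κ_d Û(ℬ) = [Û_e(𝒜_cl) − (w/d²)Û_e(𝒜)] + (w/d²)[Û_e(𝒜) − κÛ(ℬ)]`; exponents merged to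
`max c₁ c₂` using `log X ≥ 1` (`X₀ ≥ e`), constants `|C₁| + (w/d²)|C₂|`. [cite: HeathBrownMoroz2004, Lemma 4.1]
[cite: HeathBrownActa2001, Lemma 3.9] -/
theorem h39_of_leadingDifferencing (hLD : ClassLeadingDifferencing) :
    ∀ d a b : ℕ, 0 < d → a < d → b < d → Nat.Coprime (a ^ 3 + 2 * b ^ 3) d →
      ∀ σ₀ : ℝ, Tendsto singularProductPartial atTop (𝓝 σ₀) → ∀ ϖ : ℝ, 0 < ϖ → ϖ < 1 / 5 →
        ∃ c C X₀ : ℝ, ∀ X η : ℝ, X₀ ≤ X → Real.exp (-Real.log X ^ (1 / 3 : ℝ)) ≤ η → η ≤ 1 →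
          ∀ (k : ℕ) (m : Fin k → ℕ), CoreAdmissible (hbTau ϖ X) m →
            ∀ cR : Ideal (𝓞 K) → ℝ, CSupport X (hbTau ϖ X) cR →
              |bilin (classPairs X η d a b) pairIdeal cR (eWeight X (hbTau ϖ X) m) -
                  classKappa σ₀ X η d *
                    bilin (normWindow X η) (fun J => J) cR (dWeight X (hbTau ϖ X) m)| ≤
                C * (∏ i, (m i : ℝ))⁻¹ * η ^ (5 / 2 : ℝ) * X ^ 2 * Real.log X ^ c := by
  intro d a b hd ha hb hadm σ₀ hσ ϖ hϖ0 hϖ5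
  obtain ⟨c₁, C₁, X₁, h₁⟩ := hLD d a b hd ha hb hadm ϖ hϖ0 hϖ5
  obtain ⟨c₂, C₂, X₂, h₂⟩ := HeathBrown2001_lemma_3_9_holds σ₀ hσ ϖ hϖ0 hϖ5
  have hw := classWeight_div_sq_nonneg d
  refine ⟨max c₁ c₂, |C₁| + classWeight d / (d : ℝ) ^ 2 * |C₂|, max (max X₁ X₂) (Real.exp 1), ?_⟩
  intro X η hX hη hη1 k m hm cR hcR
  have hX1 : X₁ ≤ X := (le_max_left _ _).trans ((le_max_left _ _).trans hX)
  have hX2 : X₂ ≤ X := (le_max_right _ _).trans ((le_max_left _ _).trans hX)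
  have hXe : Real.exp 1 ≤ X := (le_max_right _ _).trans hX
  have hlog : 1 ≤ Real.log X := by
    have h := Real.log_le_log (Real.exp_pos 1) hXe
    rwa [Real.log_exp] at h
  have hη0 : 0 ≤ η := (Real.exp_pos _).le.trans hη
  have hM : 0 ≤ (∏ i, (m i : ℝ))⁻¹ := inv_nonneg.2 (prod_nonneg fun i _ => Nat.cast_nonneg _)
  have hE : 0 ≤ η ^ (5 / 2 : ℝ) := Real.rpow_nonneg hη0 _
  have hX2' : 0 ≤ X ^ 2 := sq_nonneg X
  have e₁ := h₁ X η hX1 hη hη1 k m hm cR hcR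
  have e₂ := h₂ X η hX2 hη hη1 k m hm cR hcR
  simp only [classKappa_def]
  refine (abs_sub_le_of_mid
    (P := bilin (boxPairs X η) pairIdeal cR (eWeight X (hbTau ϖ X) m)) hw).trans ?_
  refine (add_le_add (e₁.trans (const_rpow_mono hM hE hX2' hlog (le_max_left c₁ c₂)))
    (mul_le_mul_of_nonneg_left (e₂.trans (const_rpow_mono hM hE hX2' hlog (le_max_right c₁ c₂)))
      hw)).trans_eq ?_
  ring

/-! ## Part B — the class Type II half (this line `unit-split-positivity`): signatures, stubs E3–E5, proved
bookkeeping, and the discharge of the sibling's `ClassTypeIIBound` -/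

/-- Signature of `stub_classMainError`: passage to generators and Möbius inversion over `gcd(x, y)` for the
CLASS sum `S_V^{cl}` — main term `Σ_{(x,y) ∈ box, x ≡ a₀, y ≡ b₀ (d)} Hprim(x,y)` plus an error with the
d = 1 majorant `E_V ≪ X²(X^τ)^{-1/2}(log X)^e` ((11.2)). -/
def Sig.stub_classMainError : Prop :=
  ∃ C e : ℝ, 0 < C ∧ 0 ≤ e ∧
    ∀ (X η τ V T : ℝ) (n : ℕ) (m : Fin (n + 1) → ℕ) (c : Ideal (𝓞 K) → ℝ) (d a₀ b₀ : ℕ),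
      2 ≤ X → 0 ≤ η → η ≤ 1 → 0 < τ → τ ≤ 1 → 0 < T → CoreAdmissible τ m → CSupport X τ c →
        |bilin (classPairs X η d a₀ b₀) pairIdeal c (gCut X τ m V) -
            ∑ xy ∈ (box X η).filter (fun xy => xy.1 ≡ a₀ [MOD d] ∧ xy.2 ≡ b₀ [MOD d]),
              Hprim X τ m V T c xy| ≤
          C * X ^ 2 * (X ^ τ) ^ (-(1 / 2 : ℝ)) * Real.log X ^ e

open scoped Classical in
/-- Signature of `stub_classMainCauchy`: the residue split of the class main term over the `d³` residues
`v` of `β̂ (mod d)` followed by Cauchy's inequality of p. 68 (the class indicator, a function of `(α̂, v)`,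
is bounded by `1`): `|M_V^{cl}| ≤ (#Abox)^{1/2} Σ_v S(v)^{1/2}`, `S(v)` the dispersion sum twisted by
`[β̂ ≡ v (d)]`. -/
def Sig.stub_classMainCauchy : Prop :=
  ∀ (X η τ V T : ℝ) (k : ℕ) (m : Fin k → ℕ) (c : Ideal (𝓞 K) → ℝ) (d a₀ b₀ : ℕ),
    0 < X → η ≤ 1 → 0 < T → T ^ 3 = V → CSupport X τ c → 0 < d →
      |∑ xy ∈ (box X η).filter (fun xy => xy.1 ≡ a₀ [MOD d] ∧ xy.2 ≡ b₀ [MOD d]), Hprim X τ m V T c xy| ≤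
        Real.sqrt (#(Abox X T)) *
          ∑ v ∈ Finset.Ico (0 : ℤ) d ×ˢ (Finset.Ico (0 : ℤ) d ×ˢ Finset.Ico (0 : ℤ) d),
            Real.sqrt (∑ a ∈ (Abox X T).filter IsPrimitiveVec,
              (∑ b ∈ Bbox T, if Wab X η a b then
                  (if DvdVec (d : ℤ) (b - v) then (1 : ℝ) else 0) * Fb X τ m V T b else 0) ^ 2)

open scoped Classical in
/-- Signature of `stub_twistedSsum` (LOAD-BEARING): the bound for the twisted dispersion sum
`S_w = Σ_{α̂ prim} |Σ_β̂ w(β̂) F_β W(α̂β̂)|²`, `w` `d`-periodic with `|w| ≤ 1`, under the parameter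
inequalities of the tree's `Ssum_le_of_params` and (3.14) up to `d·Q₁` — the same four-term bound
`S ≪_d XV (Y⁻¹ + Y⁶⁰X^{-τ/2} + Y¹⁶Q₁^{-1/4} + Y¹⁶Q₁⁴e^{-c₁√log L}) (log X)^{c₀}` (Lemma 12.2 + §13). -/
def Sig.stub_twistedSsum : Prop :=
  ∃ c₀ : ℝ, 0 ≤ c₀ ∧ ∀ (κ C₁ c₅ : ℝ) (d : ℕ), 0 < κ → 0 < c₅ → 0 < d → ∃ KS : ℝ, 0 < KS ∧
    ∀ (X η τ V T Y Q₁ c₁ W : ℝ) (nn : ℕ) (m : Fin (nn + 1) → ℕ) (w : ℤ × ℤ × ℤ → ℝ),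
      (∀ b, |w b| ≤ 1) → (∀ b u, DvdVec (d : ℤ) u → w (b + u) = w b) →
      0 ≤ η → η ≤ 1 → 0 < τ → τ ≤ 1 → CoreAdmissible τ m → Hyp314 X τ m ((d : ℝ) * Q₁) C₁ c₁ 3 1 →
      2 ≤ X → 1 ≤ Real.log X → 1 ≤ Y → 1 ≤ Q₁ → Q₁ ≤ X → 2 ≤ T → T ^ 3 = V → T ≤ X → T ^ 2 ≤ 56 * X →
      W = X ^ (τ / 2) → X * W ≤ T ^ 3 → T ^ 2 * W ≤ X → Y ^ 10 * Q₁ ≤ T ^ 2 → c₅ * X * Y ^ 3 ≤ T ^ 3 →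
      Y ≤ X → Q₁ ^ (1 / 3 : ℝ) * Real.exp (-(c₁ * Real.sqrt (Real.log (hbL X τ)))) ≤ 1 →
      2 ≤ T / ((1248 * (⌊Y⌋₊ + 1) ^ 2 : ℕ) : ℝ) →
      3 * (((1248 * (⌊Y⌋₊ + 1) ^ 2 : ℕ)) : ℝ) + 2 ≤ (T / ((1248 * (⌊Y⌋₊ + 1) ^ 2 : ℕ) : ℝ)) ^ 2 →
      hbL X τ ^ 2 ≤ T / ((1248 * (⌊Y⌋₊ + 1) ^ 2 : ℕ) : ℝ) → X ≤ 270 * V →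
      270 * V / X ≤ κ * (T / ((1248 * (⌊Y⌋₊ + 1) ^ 2 : ℕ) : ℝ)) →
      1 ≤ V / (X * Y) → V / (X * Y) ≤ T → 1 ≤ T ^ 3 * Y ^ 7 / X →
        ∑ a ∈ (Abox X T).filter IsPrimitiveVec,
            (∑ b ∈ Bbox T, if Wab X η a b then w b * Fb X τ m V T b else 0) ^ 2 ≤
          KS * (X * V) * (Y⁻¹ + Y ^ 60 * X ^ (-(τ / 2)) + Y ^ 16 * Q₁ ^ (-(1 / 4 : ℝ)) +
            Y ^ 16 * Q₁ ^ 4 * Real.exp (-(c₁ * Real.sqrt (Real.log (hbL X τ))))) * Real.log X ^ c₀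

/-! ### The Type II half: E3, E4 (v5) and E5 (v6) CLOSED — all three are landed `Theorems/` theorems -/

/-- **E3 CLOSED (v5) — `stub_classMainError` is a THEOREM.** `S_V^{cl} = M_V^{cl} + E_V^{cl}` with
`|E_V^{cl}| ≤ C X² (X^τ)^{-1/2} (log X)^e` (absolute `C, e`): the lead `parity-ideate-ghb-prover-1` g3 landed
`Summit.Parity.GeneralizedHardyLittlewood.Theorems.GoldbachHeathBrownDispersionHeathBrownMorozUniform.stub_classMainError`
(p562045, `…ClassMainError.lean`: the class filter rides along `bilin_eq_sum_Hprim` / Möbius over `gcd(x,y)` and the class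
error is dominated termwise by the tree's d = 1 majorant, `exists_errorEV_bound`), whose statement is the registered signature
`Sig.stub_classMainError` VERBATIM.  No longer a stub. [cite: HeathBrownActa2001, §11 (11.2)] [cite: HeathBrownMoroz2004, Proposition 4.2] -/
theorem classMainError_holds : Sig.stub_classMainError :=
  Summit.Parity.GeneralizedHardyLittlewood.Theorems.GoldbachHeathBrownDispersionHeathBrownMorozUniform.stub_classMainError

/-- **E4 CLOSED (v5) — `stub_classMainCauchy` is a THEOREM.** The residue split of the class main term `M_V^{cl}`
over the `d³` residues `v` of `β̂ (mod d)` followed by Cauchy's inequality (HB01 p. 68; HBM04 p. 23) — the class of `α̂β̂`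
depends on `β̂ (mod d)` only, the class indicator is a function of `(α̂, v)` bounded by `1` and dies in Cauchy as `|c_α| ≤ 1`
does: the lead `parity-ideate-ghb-prover-1` g3 landed
`Summit.Parity.GeneralizedHardyLittlewood.Theorems.GoldbachHeathBrownDispersionHeathBrownMorozUniform.stub_classMainCauchy`
(p562571, `…ClassMainCauchy.lean`: `cls_imulVec_iff`, `classMain_eq_sum_cA`, `inner_cls_eq_sum_resVecs`), whose statement is
the registered signature `Sig.stub_classMainCauchy` VERBATIM.  No longer a stub.
[cite: HeathBrownActa2001, §11 p. 68] [cite: HeathBrownMoroz2004, Proposition 4.2] -/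
theorem classMainCauchy_holds : Sig.stub_classMainCauchy :=
  Summit.Parity.GeneralizedHardyLittlewood.Theorems.GoldbachHeathBrownDispersionHeathBrownMorozUniform.stub_classMainCauchy

/-- **E5 CLOSED (v6) — `stub_twistedSsum` is a THEOREM (the line's LOAD-BEARING stub, the last to land).**
Heath-Brown's dispersion bound (Lemma 12.2 + §13, tree `Ssum_le_of_params`) for the twisted weight `w(β̂)F_β`,
`w : ℤ³ → ℝ` `d`-periodic with `|w| ≤ 1`, under (3.14) up to `d·Q₁` (all other parameter inequalities verbatim those
of `Ssum_le_of_params`; `KS = KS(d, κ, C₁, c₅)`): the lead `parity-ideate-ghb-prover-1` g3 landed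
`Summit.Parity.GeneralizedHardyLittlewood.Theorems.GoldbachHeathBrownDispersionHeathBrownMorozUniform.stub_twistedSsum`
(p565095, `…TwistedSsum.lean`, over the twisted §§11–13 re-run `Literature.NumberTheory.Sieve.CubicSieve.Twisted.*`:
`S = S₁ + S₂`, `S₂ → S₃ + S₄`, localisation into cubes, class I / class II split and the large sieve with arbitrary
coefficients, and the ONE arithmetic step `SmallQ` — a class `β̂ ≡ c (q), g ∣ β̂, β̂ ≡ r (d)` is one class modulo
`lcm(g,q,d) ≤ d·Q₁`, where `Hyp314 X τ m (d·Q₁)` applies with `d³` times as many classes), whose statement is the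
registered signature `Sig.stub_twistedSsum` VERBATIM.  The prediction of the idea card held: no step of §§12–13 uses an
identity in `F` beyond `|F_β| ≤ 9τ((β))`, support, the Möbius identity and (3.14).  No longer a stub.
[cite: HeathBrownActa2001, Lemma 12.2, §13 pp. 82–83] [cite: HeathBrownMoroz2004, Proposition 4.2] -/
theorem twistedSsum_holds : Sig.stub_twistedSsum :=
  Summit.Parity.GeneralizedHardyLittlewood.Theorems.GoldbachHeathBrownDispersionHeathBrownMorozUniform.stub_twistedSsum

/-! ### Proved glue: from the three Type II stubs to the class Lemma 3.10 -/

/-- `D ∣ u` componentwise ⇒ (`D ∣ b + u − v` componentwise iff `D ∣ b − v` componentwise). [folklore] -/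
theorem dvdVec_add_sub_iff {D : ℤ} {b u v : ℤ × ℤ × ℤ} (hu : DvdVec D u) :
    DvdVec D (b + u - v) ↔ DvdVec D (b - v) := by
  obtain ⟨h1, h2, h3⟩ := hu
  have key : ∀ {x y z : ℤ}, D ∣ y → (D ∣ x + y - z ↔ D ∣ x - z) := by
    intro x y z hy
    rw [show x + y - z = (x - z) + y by ring]
    exact dvd_add_left hy
  simp only [DvdVec, Prod.fst_add, Prod.snd_add, Prod.fst_sub, Prod.snd_sub]
  rw [key h1, key h2, key h3]

set_option maxHeartbeats 1600000 in
open scoped Classical in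
/-- **Class `SV_le_of_params`** (Lemma 12.2 with §13 for the class family): under the parameter
inequalities of the tree's `SV_le_of_params`, with (3.14) up to `d·Q₁`,
`|S_V^{cl}| ≤ K·X²·(Y^{−1/2} + Y³⁰X^{−τ/4} + Y⁸Q₁^{−1/8} + Y⁸Q₁²e^{−(c₁/2)√(log L)})(log X)^{c₀}`,
`K = K(d, κ, C₁, c₅)` — from stubs 3, 4, 5 (main + error, residue split + Cauchy, twisted `S`), the
arithmetic being that of the tree's `SV_le_of_params`. [cite: HeathBrownActa2001, Lemma 12.2, §13 p. 83] -/
theorem classSV_le_of_params (h3 : Sig.stub_classMainError) (h4 : Sig.stub_classMainCauchy)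
    (h5 : Sig.stub_twistedSsum) :
    ∃ c₀ : ℝ, 0 ≤ c₀ ∧ ∀ (κ C₁ c₅ : ℝ) (d : ℕ), 0 < κ → 0 < c₅ → 0 < d → ∃ Kc : ℝ, 0 < Kc ∧
      ∀ (X η τ V T Y Q₁ c₁ W : ℝ) (nn : ℕ) (m : Fin (nn + 1) → ℕ) (cR : Ideal (𝓞 K) → ℝ) (a₀ b₀ : ℕ),
        0 ≤ η → η ≤ 1 → 0 < τ → τ ≤ 1 → CoreAdmissible τ m → Hyp314 X τ m ((d : ℝ) * Q₁) C₁ c₁ 3 1 →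
        CSupport X τ cR →
        2 ≤ X → 1 ≤ Real.log X → 1 ≤ Y → 1 ≤ Q₁ → Q₁ ≤ X → 2 ≤ T → T ^ 3 = V → T ≤ X → T ^ 2 ≤ 56 * X →
        W = X ^ (τ / 2) → X * W ≤ T ^ 3 → T ^ 2 * W ≤ X → Y ^ 10 * Q₁ ≤ T ^ 2 → c₅ * X * Y ^ 3 ≤ T ^ 3 →
        Y ≤ X → Q₁ ^ (1 / 3 : ℝ) * Real.exp (-(c₁ * Real.sqrt (Real.log (hbL X τ)))) ≤ 1 →
        2 ≤ T / ((1248 * (⌊Y⌋₊ + 1) ^ 2 : ℕ) : ℝ) →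
        3 * (((1248 * (⌊Y⌋₊ + 1) ^ 2 : ℕ)) : ℝ) + 2 ≤ (T / ((1248 * (⌊Y⌋₊ + 1) ^ 2 : ℕ) : ℝ)) ^ 2 →
        hbL X τ ^ 2 ≤ T / ((1248 * (⌊Y⌋₊ + 1) ^ 2 : ℕ) : ℝ) → X ≤ 270 * V →
        270 * V / X ≤ κ * (T / ((1248 * (⌊Y⌋₊ + 1) ^ 2 : ℕ) : ℝ)) →
        1 ≤ V / (X * Y) → V / (X * Y) ≤ T → 1 ≤ T ^ 3 * Y ^ 7 / X →
        |bilin (classPairs X η d a₀ b₀) pairIdeal cR (gCut X τ m V)| ≤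
          Kc * X ^ 2 * (Y ^ (-(1 / 2 : ℝ)) + Y ^ 30 * X ^ (-(τ / 4)) + Y ^ 8 * Q₁ ^ (-(1 / 8 : ℝ)) +
            Y ^ 8 * Q₁ ^ 2 * Real.exp (-(c₁ / 2 * Real.sqrt (Real.log (hbL X τ))))) * Real.log X ^ c₀ := by
  classical
  obtain ⟨CE, eE, hCE, heE, hErr⟩ := h3
  obtain ⟨c₀, hc₀0, H5⟩ := h5
  refine ⟨c₀ + eE, by positivity, fun κ C₁ c₅ d hκ hc₅ hd => ?_⟩
  obtain ⟨KS, hKS0, HK⟩ := H5 κ C₁ c₅ d hκ hc₅ hd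
  have hd0 : (0 : ℝ) < d := Nat.cast_pos.mpr hd
  refine ⟨(d : ℝ) ^ 3 * Real.sqrt (3375 * KS) + CE, by positivity, ?_⟩
  intro X η τ V T Y Q₁ c₁ W nn m cR a₀ b₀ hη0 hη1 hτ hτ1 hm hHyp hcR hX hlogX hY hQ₁ hQ₁X hT2 hTV hTX hT56 hW
    hXW hTW hYQ hc₅V hYX hQe hs2 hsN hsL hVX hκs hΔ1 hΔT hd₀
  have hX0 : 0 < X := by linarith
  have hT : 0 < T := by linarith
  have hY0 : 0 < Y := by linarith
  have hQ₁0 : 0 < Q₁ := by linarith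
  have hV0 : 0 < V := by rw [← hTV]; positivity
  -- the three inputs, instantiated
  have hM1 := h4 X η τ V T (nn + 1) m cR d a₀ b₀ hX0 hη1 hT hTV hcR hd
  have hE1 := hErr X η τ V T nn m cR d a₀ b₀ hX hη0 hη1 hτ hτ1 hT hm hcR
  have hSvB : ∀ v : ℤ × ℤ × ℤ,
      ∑ a ∈ (Abox X T).filter IsPrimitiveVec,
          (∑ b ∈ Bbox T, if Wab X η a b then
              (if DvdVec (d : ℤ) (b - v) then (1 : ℝ) else 0) * Fb X τ m V T b else 0) ^ 2 ≤
        KS * (X * V) * (Y⁻¹ + Y ^ 60 * X ^ (-(τ / 2)) + Y ^ 16 * Q₁ ^ (-(1 / 4 : ℝ)) +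
          Y ^ 16 * Q₁ ^ 4 * Real.exp (-(c₁ * Real.sqrt (Real.log (hbL X τ))))) * Real.log X ^ c₀ := by
    intro v
    have hw1 : ∀ b : ℤ × ℤ × ℤ, |(if DvdVec (d : ℤ) (b - v) then (1 : ℝ) else 0)| ≤ 1 := by
      intro b; split_ifs <;> simp
    have hw2 : ∀ b u : ℤ × ℤ × ℤ, DvdVec (d : ℤ) u →
        (if DvdVec (d : ℤ) (b + u - v) then (1 : ℝ) else 0) =
          (if DvdVec (d : ℤ) (b - v) then (1 : ℝ) else 0) := by
      intro b u hu
      rw [show (DvdVec (d : ℤ) (b + u - v)) = (DvdVec (d : ℤ) (b - v)) from propext (dvdVec_add_sub_iff hu)]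
    exact HK X η τ V T Y Q₁ c₁ W nn m (fun b => if DvdVec (d : ℤ) (b - v) then (1 : ℝ) else 0) hw1 hw2
      hη0 hη1 hτ hτ1 hm hHyp hX hlogX hY hQ₁ hQ₁X hT2 hTV hTX hT56 hW hXW hTW hYQ hc₅V hYX hQe hs2 hsN hsL
      hVX hκs hΔ1 hΔT hd₀
  -- the four terms
  obtain ⟨e₁, e₂', e₃', e₄⟩ :=
    four_terms_sq (τ := τ) (c := c₁) (u := Real.sqrt (Real.log (hbL X τ))) hX0 hY0 hQ₁0
  set U : ℝ := Y⁻¹ + Y ^ 60 * X ^ (-(τ / 2)) + Y ^ 16 * Q₁ ^ (-(1 / 4 : ℝ)) +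
    Y ^ 16 * Q₁ ^ 4 * Real.exp (-(c₁ * Real.sqrt (Real.log (hbL X τ)))) with hU
  have hUt : U = (Y ^ (-(1 / 2 : ℝ))) ^ 2 + (Y ^ 30 * X ^ (-(τ / 4))) ^ 2 + (Y ^ 8 * Q₁ ^ (-(1 / 8 : ℝ))) ^ 2 +
      (Y ^ 8 * Q₁ ^ 2 * Real.exp (-(c₁ / 2 * Real.sqrt (Real.log (hbL X τ))))) ^ 2 := by
    rw [hU, e₁, e₂', e₃', e₄]
  have ht₁0 : 0 ≤ Y ^ (-(1 / 2 : ℝ)) := Real.rpow_nonneg hY0.le _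
  have ht₂0 : 0 ≤ Y ^ 30 * X ^ (-(τ / 4)) := mul_nonneg (by positivity) (Real.rpow_nonneg hX0.le _)
  have ht₃0 : 0 ≤ Y ^ 8 * Q₁ ^ (-(1 / 8 : ℝ)) := mul_nonneg (by positivity) (Real.rpow_nonneg hQ₁0.le _)
  have ht₄0 : 0 ≤ Y ^ 8 * Q₁ ^ 2 * Real.exp (-(c₁ / 2 * Real.sqrt (Real.log (hbL X τ)))) := by positivity
  have hU0 : 0 ≤ U := by rw [hUt]; positivity
  set St : ℝ := Y ^ (-(1 / 2 : ℝ)) + Y ^ 30 * X ^ (-(τ / 4)) + Y ^ 8 * Q₁ ^ (-(1 / 8 : ℝ)) +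
    Y ^ 8 * Q₁ ^ 2 * Real.exp (-(c₁ / 2 * Real.sqrt (Real.log (hbL X τ)))) with hSt
  have hsqrtU : Real.sqrt U ≤ St := by rw [hUt]; exact sqrt_sum_four_le ht₁0 ht₂0 ht₃0 ht₄0
  have hSt0 : 0 ≤ St := by positivity
  have ht₂St : X ^ (-(τ / 4)) ≤ St := by
    have h2 : X ^ (-(τ / 4)) ≤ Y ^ 30 * X ^ (-(τ / 4)) :=
      le_mul_of_one_le_left (Real.rpow_nonneg hX0.le _) (one_le_pow₀ hY)
    linarith
  -- logarithms
  set LX := Real.log X with hLX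
  have hLX0 : 0 ≤ LX := by linarith
  -- the twisted `S(v)` are uniformly bounded by `B`
  set B : ℝ := KS * (X * V) * U * LX ^ c₀ with hB
  have hB0 : 0 ≤ B :=
    mul_nonneg (mul_nonneg (mul_nonneg hKS0.le (mul_pos hX0 hV0).le) hU0) (Real.rpow_nonneg hLX0 _)
  -- the residue set has `d³` elements
  have hcard : (#(Finset.Ico (0 : ℤ) d ×ˢ (Finset.Ico (0 : ℤ) d ×ˢ Finset.Ico (0 : ℤ) d)) : ℝ) = (d : ℝ) ^ 3 := by
    rw [card_product, card_product, Int.card_Ico, sub_zero, Int.toNat_natCast]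
    push_cast; ring
  have hsum : ∑ v ∈ Finset.Ico (0 : ℤ) d ×ˢ (Finset.Ico (0 : ℤ) d ×ˢ Finset.Ico (0 : ℤ) d),
      Real.sqrt (∑ a ∈ (Abox X T).filter IsPrimitiveVec,
        (∑ b ∈ Bbox T, if Wab X η a b then
            (if DvdVec (d : ℤ) (b - v) then (1 : ℝ) else 0) * Fb X τ m V T b else 0) ^ 2) ≤
      (d : ℝ) ^ 3 * Real.sqrt B := by
    refine (sum_le_sum fun v _ => Real.sqrt_le_sqrt (hSvB v)).trans ?_
    rw [sum_const, nsmul_eq_mul, hcard]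
  -- `#Abox ≤ (15X/T)³`
  have hA : (#(Abox X T) : ℝ) ≤ (15 * X / T) ^ 3 := by
    refine (card_Abox_le hX0.le hT).trans ?_
    have : 14 * X / T + 1 ≤ 15 * X / T := by
      rw [div_add_one hT.ne', div_le_div_iff_of_pos_right hT]; linarith
    exact pow_le_pow_left₀ (by positivity) this 3
  -- the core computation of p. 68 / p. 83: `(#Abox)^{1/2} B^{1/2} ≤ √(3375 KS) X² St LX^{c₀+eE}`
  have hcore : Real.sqrt (#(Abox X T)) * Real.sqrt B ≤ Real.sqrt (3375 * KS) * X ^ 2 * St * LX ^ (c₀ + eE) := by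
    have h1 : Real.sqrt (#(Abox X T)) * Real.sqrt B ≤ Real.sqrt ((15 * X / T) ^ 3) * Real.sqrt B :=
      mul_le_mul_of_nonneg_right (Real.sqrt_le_sqrt hA) (Real.sqrt_nonneg _)
    refine h1.trans ?_
    rw [← Real.sqrt_mul (by positivity)]
    have e : (15 * X / T) ^ 3 * B = (3375 * KS) * (X ^ 2) ^ 2 * (U * LX ^ c₀) := by
      rw [hB, ← hTV]; field_simp; ring
    rw [e, Real.sqrt_mul (by positivity), Real.sqrt_mul (by positivity), Real.sqrt_sq (by positivity),
      Real.sqrt_mul hU0]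
    have hL1 : Real.sqrt (LX ^ c₀) ≤ LX ^ (c₀ + eE) := by
      rw [Real.sqrt_eq_rpow, ← Real.rpow_mul hLX0]
      exact Real.rpow_le_rpow_of_exponent_le hlogX (by linarith)
    have hL0 : 0 ≤ Real.sqrt (LX ^ c₀) := Real.sqrt_nonneg _
    calc Real.sqrt (3375 * KS) * X ^ 2 * (Real.sqrt U * Real.sqrt (LX ^ c₀))
        ≤ Real.sqrt (3375 * KS) * X ^ 2 * (St * LX ^ (c₀ + eE)) := by gcongr
      _ = _ := by ring
  -- the main term
  have hmain : |∑ xy ∈ (box X η).filter (fun xy => xy.1 ≡ a₀ [MOD d] ∧ xy.2 ≡ b₀ [MOD d]),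
      Hprim X τ m V T cR xy| ≤ (d : ℝ) ^ 3 * Real.sqrt (3375 * KS) * X ^ 2 * St * LX ^ (c₀ + eE) := by
    refine hM1.trans ?_
    calc Real.sqrt (#(Abox X T)) *
          ∑ v ∈ Finset.Ico (0 : ℤ) d ×ˢ (Finset.Ico (0 : ℤ) d ×ˢ Finset.Ico (0 : ℤ) d),
            Real.sqrt (∑ a ∈ (Abox X T).filter IsPrimitiveVec,
              (∑ b ∈ Bbox T, if Wab X η a b then
                  (if DvdVec (d : ℤ) (b - v) then (1 : ℝ) else 0) * Fb X τ m V T b else 0) ^ 2)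
        ≤ Real.sqrt (#(Abox X T)) * ((d : ℝ) ^ 3 * Real.sqrt B) :=
          mul_le_mul_of_nonneg_left hsum (Real.sqrt_nonneg _)
      _ = (d : ℝ) ^ 3 * (Real.sqrt (#(Abox X T)) * Real.sqrt B) := by ring
      _ ≤ (d : ℝ) ^ 3 * (Real.sqrt (3375 * KS) * X ^ 2 * St * LX ^ (c₀ + eE)) :=
          mul_le_mul_of_nonneg_left hcore (by positivity)
      _ = _ := by ring
  -- the error term
  have herr : |bilin (classPairs X η d a₀ b₀) pairIdeal cR (gCut X τ m V) -
      ∑ xy ∈ (box X η).filter (fun xy => xy.1 ≡ a₀ [MOD d] ∧ xy.2 ≡ b₀ [MOD d]), Hprim X τ m V T cR xy| ≤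
      CE * X ^ 2 * St * LX ^ (c₀ + eE) := by
    have hXt : (X ^ τ) ^ (-(1 / 2 : ℝ)) ≤ St := by
      have e : (X ^ τ) ^ (-(1 / 2 : ℝ)) = X ^ (-(τ / 2)) := by rw [← Real.rpow_mul hX0.le]; ring_nf
      rw [e]
      have h1 : X ^ (-(τ / 2)) ≤ X ^ (-(τ / 4)) := Real.rpow_le_rpow_of_exponent_le (by linarith) (by linarith)
      linarith
    have hLe : LX ^ eE ≤ LX ^ (c₀ + eE) := Real.rpow_le_rpow_of_exponent_le hlogX (by linarith)
    have hX0' : 0 ≤ (X ^ τ) ^ (-(1 / 2 : ℝ)) := Real.rpow_nonneg (Real.rpow_nonneg hX0.le _) _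
    calc |bilin (classPairs X η d a₀ b₀) pairIdeal cR (gCut X τ m V) -
          ∑ xy ∈ (box X η).filter (fun xy => xy.1 ≡ a₀ [MOD d] ∧ xy.2 ≡ b₀ [MOD d]), Hprim X τ m V T cR xy|
        ≤ CE * X ^ 2 * (X ^ τ) ^ (-(1 / 2 : ℝ)) * LX ^ eE := hE1
      _ ≤ CE * X ^ 2 * St * LX ^ (c₀ + eE) := by gcongr
  -- `S_V^{cl} = M + E`
  have hsplit : bilin (classPairs X η d a₀ b₀) pairIdeal cR (gCut X τ m V) =
      (∑ xy ∈ (box X η).filter (fun xy => xy.1 ≡ a₀ [MOD d] ∧ xy.2 ≡ b₀ [MOD d]), Hprim X τ m V T cR xy) +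
        (bilin (classPairs X η d a₀ b₀) pairIdeal cR (gCut X τ m V) -
          ∑ xy ∈ (box X η).filter (fun xy => xy.1 ≡ a₀ [MOD d] ∧ xy.2 ≡ b₀ [MOD d]), Hprim X τ m V T cR xy) := by
    ring
  rw [hsplit]
  refine (abs_add_le _ _).trans ?_
  calc |∑ xy ∈ (box X η).filter (fun xy => xy.1 ≡ a₀ [MOD d] ∧ xy.2 ≡ b₀ [MOD d]), Hprim X τ m V T cR xy| +
        |bilin (classPairs X η d a₀ b₀) pairIdeal cR (gCut X τ m V) -
          ∑ xy ∈ (box X η).filter (fun xy => xy.1 ≡ a₀ [MOD d] ∧ xy.2 ≡ b₀ [MOD d]), Hprim X τ m V T cR xy|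
      ≤ (d : ℝ) ^ 3 * Real.sqrt (3375 * KS) * X ^ 2 * St * LX ^ (c₀ + eE) + CE * X ^ 2 * St * LX ^ (c₀ + eE) :=
        add_le_add hmain herr
    _ = ((d : ℝ) ^ 3 * Real.sqrt (3375 * KS) + CE) * X ^ 2 * St * LX ^ (c₀ + eE) := by ring

set_option maxHeartbeats 2000000 in
open scoped Classical in
/-- **The class bound of p. 83**: `S_V^{cl} ≤ C X²(Y^{−1/2} + Y³⁰X^{−τ/4} + Y⁸Q₁^{−1/8} + Y⁸Q₁²e^{−c₂√(log L)})(log X)^c`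
for `X ≥ X₀`, `1 ≤ Y ≤ X^{τ/3}`, under (3.14) up to `d·Q₁` with `c₃ = 3`, `c₄ = 1` — the tree's
`SV_bound_p83` for the class family (`T = V^{1/3}`, `final_param_ineqs`, `eventually_final_params`).
[cite: HeathBrownActa2001, §13 p. 83] -/
theorem class_p83 (h3 : Sig.stub_classMainError) (h4 : Sig.stub_classMainCauchy)
    (h5 : Sig.stub_twistedSsum) : ∀ d a₀ b₀ : ℕ, 0 < d → ∀ ϖ : ℝ, 0 < ϖ → ϖ < 1 / 5 →
    ∃ c c₃ c₄ : ℝ, 0 < c₃ ∧ 0 < c₄ ∧ ∀ C₁ c₁ c₅ c₆ : ℝ, 0 < c₁ → 0 < c₅ → 0 < c₆ →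
      ∃ C c₂ X₀ : ℝ, 0 < c₂ ∧ ∀ X η Q₁ Y : ℝ, X₀ ≤ X → Real.exp (-Real.log X ^ (1 / 3 : ℝ)) ≤ η →
        η ≤ 1 → 1 ≤ Q₁ → Q₁ ≤ Real.exp (Real.log X ^ (1 / 3 : ℝ)) → 1 ≤ Y →
          Y ≤ X ^ (hbTau ϖ X / 3) →
          (∀ (k' : ℕ) (m' : Fin k' → ℕ), CoreAdmissible (hbTau ϖ X) m' →
            Hyp314 X (hbTau ϖ X) m' ((d : ℝ) * Q₁) C₁ c₁ c₃ c₄) →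
            ∀ (k : ℕ) (m : Fin k → ℕ), CoreAdmissible (hbTau ϖ X) m →
              ∀ cR : Ideal (𝓞 K) → ℝ, CSupport X (hbTau ϖ X) cR →
                ∀ V : ℝ, c₅ * X ^ (1 + hbTau ϖ X) ≤ V → V ≤ c₆ * X ^ (3 / 2 - hbTau ϖ X) →
                  |bilin (classPairs X η d a₀ b₀) pairIdeal cR
                      (fun S => if V < (Ideal.absNorm S : ℝ) ∧ (Ideal.absNorm S : ℝ) ≤ 2 * V then
                        fWeight X (hbTau ϖ X) m S else 0)| ≤
                    C * X ^ 2 * (Y ^ (-(1 / 2 : ℝ)) + Y ^ 30 * X ^ (-(hbTau ϖ X / 4)) +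
                      Y ^ 8 * Q₁ ^ (-(1 / 8 : ℝ)) +
                      Y ^ 8 * Q₁ ^ 2 * Real.exp (-(c₂ * Real.sqrt (Real.log (hbL X (hbTau ϖ X)))))) *
                      Real.log X ^ c := by
  intro d a₀ b₀ hd ϖ hϖ0 _hϖ5
  obtain ⟨c₀, -, H⟩ := classSV_le_of_params h3 h4 h5
  refine ⟨c₀, 3, 1, by norm_num, by norm_num, fun C₁ c₁ c₅ c₆ hc₁ hc₅ hc₆ => ?_⟩
  have hκ0 : (0 : ℝ) < 270 * 4992 * (c₆ ^ (1 / 3 : ℝ)) ^ 2 + 1 := by positivity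
  obtain ⟨Kc, hKc, HK⟩ := H _ C₁ c₅ d hκ0 hc₅ hd
  obtain ⟨X₀, hX₀⟩ := Filter.eventually_atTop.mp
    (eventually_final_params hϖ0 ((c₆ ^ (1 / 3 : ℝ)) ^ 2 + 1 / c₅ + 1 / (270 * c₅) + 1)
      (2 / c₅ ^ (1 / 3 : ℝ) + c₆ ^ (1 / 3 : ℝ) + 2 * 4992 / c₅ ^ (1 / 3 : ℝ) +
        24960 * 4992 ^ 2 / (c₅ ^ (1 / 3 : ℝ)) ^ 2 + 4992 / c₅ ^ (1 / 3 : ℝ) + 1) hc₁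
      (Real.rpow_pos_of_pos hc₅ (2 / 3 : ℝ)))
  refine ⟨Kc, c₁ / 2, X₀, by positivity, ?_⟩
  intro X η Q₁ Y hXX₀ hη1 hη2 hQ₁ hQ₁2 hY1 hY2 hHyp k m hm cR hcR V hV1 hV2
  obtain ⟨hX2, hL1, hτ0, hτ8, hP, hR, hE7, hC8⟩ := hX₀ X hXX₀
  -- no admissible `𝐦` with `k = 0`
  cases k with
  | zero => exact (not_coreAdmissible_zero hτ0 m hm).elim
  | succ n =>
  obtain ⟨hQ₁X, hT2, hTV, hTX, hT56, hXW, hT2W, hYQ, hc₅V, hYX, hQe, hs2, hsN, hsL, hVX, hκs, hΔ1, hΔT, hd₀⟩ :=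
    final_param_ineqs (c₁ := c₁) hX2 hL1 hτ0 hτ8 hc₅ hc₆ hP hR hE7 hC8 hV1 hV2 hY1 hY2 hQ₁ hQ₁2
  have hη0 : 0 ≤ η := le_trans (Real.exp_pos _).le hη1
  have hτ1 : hbTau ϖ X ≤ 1 := by linarith
  -- apply the core bound
  have hmain := HK X η (hbTau ϖ X) V (V ^ (1 / 3 : ℝ)) Y Q₁ c₁ (X ^ (hbTau ϖ X / 2)) n m cR a₀ b₀ hη0 hη2 hτ0
    hτ1 hm (hHyp _ m hm) hcR hX2 hL1 hY1 hQ₁ hQ₁X hT2 hTV hTX hT56 rfl hXW hT2W hYQ hc₅V hYX hQe hs2 hsN hsL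
    hVX hκs hΔ1 hΔT hd₀
  have hg : (fun S : Ideal (𝓞 K) => if V < (Ideal.absNorm S : ℝ) ∧ (Ideal.absNorm S : ℝ) ≤ 2 * V then
      fWeight X (hbTau ϖ X) m S else 0) = gCut X (hbTau ϖ X) m V := by
    funext S; unfold gCut; congr 1
  rw [hg]
  exact hmain

open scoped Classical in
/-- **Class Lemma 3.10 by the choice `Y = Q₁^{1/80}` ((13.7))** — the tree's
`HeathBrown2001_lemma_3_10_of_SV_bound` for the class family, with (3.14) up to `d·Q₁`:
`S_V^{cl} ≪ X² Q₁^{−1/160} (log X)^c`. [cite: HeathBrownActa2001, §13 p. 83, (13.7)] -/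
theorem class_310 (h3 : Sig.stub_classMainError) (h4 : Sig.stub_classMainCauchy)
    (h5 : Sig.stub_twistedSsum) : ∀ d a₀ b₀ : ℕ, 0 < d → ∀ ϖ : ℝ, 0 < ϖ → ϖ < 1 / 5 →
    ∃ c c₃ c₄ : ℝ, 0 < c₃ ∧ 0 < c₄ ∧ ∀ C₁ c₁ c₅ c₆ : ℝ, 0 < c₁ → 0 < c₅ → 0 < c₆ →
      ∃ C X₀ : ℝ, ∀ X η Q₁ : ℝ, X₀ ≤ X → Real.exp (-Real.log X ^ (1 / 3 : ℝ)) ≤ η → η ≤ 1 →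
        1 ≤ Q₁ → Q₁ ≤ Real.exp (Real.log X ^ (1 / 3 : ℝ)) →
          (∀ (k' : ℕ) (m' : Fin k' → ℕ), CoreAdmissible (hbTau ϖ X) m' →
            Hyp314 X (hbTau ϖ X) m' ((d : ℝ) * Q₁) C₁ c₁ c₃ c₄) →
            ∀ (k : ℕ) (m : Fin k → ℕ), CoreAdmissible (hbTau ϖ X) m →
              ∀ cR : Ideal (𝓞 K) → ℝ, CSupport X (hbTau ϖ X) cR →
                ∀ V : ℝ, c₅ * X ^ (1 + hbTau ϖ X) ≤ V → V ≤ c₆ * X ^ (3 / 2 - hbTau ϖ X) →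
                  |bilin (classPairs X η d a₀ b₀) pairIdeal cR
                      (fun S => if V < (Ideal.absNorm S : ℝ) ∧ (Ideal.absNorm S : ℝ) ≤ 2 * V then
                        fWeight X (hbTau ϖ X) m S else 0)| ≤
                    C * X ^ 2 * Q₁ ^ (-(1 / 160 : ℝ)) * Real.log X ^ c := by
  intro d a₀ b₀ hd ϖ hϖ0 hϖ5
  obtain ⟨c, c₃, c₄, hc₃, hc₄, H⟩ := class_p83 h3 h4 h5 d a₀ b₀ hd ϖ hϖ0 hϖ5
  refine ⟨c, c₃, c₄, hc₃, hc₄, fun C₁ c₁ c₅ c₆ hc₁ hc₅ hc₆ => ?_⟩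
  obtain ⟨C, c₂, X₀, hc₂, HX⟩ := H C₁ c₁ c₅ c₆ hc₁ hc₅ hc₆
  obtain ⟨X₁, hX₁⟩ := Filter.eventually_atTop.mp (eventually_reduction_params ϖ hc₂)
  refine ⟨4 * max C 0, max X₀ X₁,
    fun X η Q₁ hX hη1 hη2 hQ1 hQ2 hHyp k m hm cR hcR V hV1 hV2 => ?_⟩
  obtain ⟨hX2, hL1, hτpos, hA, hB, hC⟩ := hX₁ X (le_of_max_le_right hX)
  have hXX₀ : X₀ ≤ X := le_of_max_le_left hX
  have hX0 : 0 < X := by linarith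
  have hLpos : 0 < Real.log X := by linarith
  have hQpos : 0 < Q₁ := by linarith
  -- the choice `Y = Q₁^{1/80}`
  obtain ⟨Y, hYdef⟩ : ∃ Y : ℝ, Y = Q₁ ^ (1 / 80 : ℝ) := ⟨_, rfl⟩
  have hY1 : 1 ≤ Y := hYdef ▸ Real.one_le_rpow hQ1 (by norm_num)
  have hYpos : 0 < Y := by linarith
  have hQpow : ∀ a : ℝ, 0 ≤ a → Q₁ ^ a ≤ Real.exp (a * Real.log X ^ (1 / 3 : ℝ)) := by
    intro a ha
    calc Q₁ ^ a ≤ (Real.exp (Real.log X ^ (1 / 3 : ℝ))) ^ a := Real.rpow_le_rpow hQpos.le hQ2 ha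
      _ = Real.exp (a * Real.log X ^ (1 / 3 : ℝ)) := by rw [← Real.exp_mul, mul_comm]
  have hXpow : ∀ s : ℝ, X ^ s = Real.exp (s * Real.log X) := fun s => by
    rw [Real.rpow_def_of_pos hX0, mul_comm]
  have hYX : Y ≤ X ^ (hbTau ϖ X / 3) := by
    calc Y = Q₁ ^ (1 / 80 : ℝ) := hYdef
      _ ≤ Real.exp ((1 / 80) * Real.log X ^ (1 / 3 : ℝ)) := hQpow _ (by norm_num)
      _ ≤ Real.exp (hbTau ϖ X / 3 * Real.log X) :=
          Real.exp_le_exp.mpr (hA.trans_eq (by ring))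
      _ = X ^ (hbTau ϖ X / 3) := (hXpow _).symm
  have hmain := HX X η Q₁ Y hXX₀ hη1 hη2 hQ1 hQ2 hY1 hYX hHyp k m hm cR hcR V hV1 hV2
  -- the four terms are each `≤ T = Q₁^{-1/160}`
  obtain ⟨T, hT⟩ : ∃ T : ℝ, T = Q₁ ^ (-(1 / 160 : ℝ)) := ⟨_, rfl⟩
  have hTpos : 0 < T := hT ▸ Real.rpow_pos_of_pos hQpos _
  have h1 : Y ^ (-(1 / 2 : ℝ)) = T := by
    rw [hYdef, hT, ← Real.rpow_mul hQpos.le]; norm_num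
  have h2 : Y ^ 30 * X ^ (-(hbTau ϖ X / 4)) ≤ T := by
    have e1 : Y ^ 30 = Q₁ ^ (3 / 8 : ℝ) := by
      rw [hYdef, ← Real.rpow_natCast, ← Real.rpow_mul hQpos.le]; norm_num
    have e2 : Q₁ ^ (3 / 8 : ℝ) = T * Q₁ ^ (61 / 160 : ℝ) := by
      rw [hT, ← Real.rpow_add hQpos]; norm_num
    have e3 : Q₁ ^ (61 / 160 : ℝ) ≤ X ^ (hbTau ϖ X / 4) := by
      calc Q₁ ^ (61 / 160 : ℝ) ≤ Real.exp ((61 / 160) * Real.log X ^ (1 / 3 : ℝ)) :=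
            hQpow _ (by norm_num)
        _ ≤ Real.exp (hbTau ϖ X / 4 * Real.log X) :=
            Real.exp_le_exp.mpr (hB.trans_eq (by ring))
        _ = X ^ (hbTau ϖ X / 4) := (hXpow _).symm
    have hXτ : 0 < X ^ (hbTau ϖ X / 4) := Real.rpow_pos_of_pos hX0 _
    rw [e1, e2, Real.rpow_neg hX0.le, mul_assoc]
    calc T * (Q₁ ^ (61 / 160 : ℝ) * (X ^ (hbTau ϖ X / 4))⁻¹) ≤ T * 1 := by
          refine mul_le_mul_of_nonneg_left ?_ hTpos.le
          rw [mul_inv_le_iff₀ hXτ, one_mul]; exact e3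
      _ = T := mul_one T
  have h3' : Y ^ 8 * Q₁ ^ (-(1 / 8 : ℝ)) ≤ T := by
    have e1 : Y ^ 8 * Q₁ ^ (-(1 / 8 : ℝ)) = Q₁ ^ (-(1 / 40 : ℝ)) := by
      rw [hYdef, ← Real.rpow_natCast, ← Real.rpow_mul hQpos.le, ← Real.rpow_add hQpos]
      norm_num
    rw [e1, hT]
    exact Real.rpow_le_rpow_of_exponent_le hQ1 (by norm_num)
  have h4' : Y ^ 8 * Q₁ ^ 2 * Real.exp (-(c₂ * Real.sqrt (Real.log (hbL X (hbTau ϖ X))))) ≤ T := by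
    have e1 : Y ^ 8 * Q₁ ^ 2 = T * Q₁ ^ (337 / 160 : ℝ) := by
      rw [hYdef, ← Real.rpow_natCast, ← Real.rpow_mul hQpos.le, ← Real.rpow_natCast Q₁ 2,
        ← Real.rpow_add hQpos, hT, ← Real.rpow_add hQpos]
      norm_num
    have e2 : Real.log (hbL X (hbTau ϖ X)) = hbTau ϖ X * Real.log X / 2 := by
      rw [hbL, Real.log_rpow hX0]; ring
    have e3 : Q₁ ^ (337 / 160 : ℝ) ≤
        Real.exp (c₂ * Real.sqrt (Real.log (hbL X (hbTau ϖ X)))) := by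
      calc Q₁ ^ (337 / 160 : ℝ) ≤ Real.exp ((337 / 160) * Real.log X ^ (1 / 3 : ℝ)) :=
            hQpow _ (by norm_num)
        _ ≤ Real.exp (c₂ * Real.sqrt (Real.log (hbL X (hbTau ϖ X)))) := by
            rw [e2]; exact Real.exp_le_exp.mpr hC
    have hE : 0 < Real.exp (c₂ * Real.sqrt (Real.log (hbL X (hbTau ϖ X)))) := Real.exp_pos _
    rw [e1, Real.exp_neg, mul_assoc]
    calc T * (Q₁ ^ (337 / 160 : ℝ) *
          (Real.exp (c₂ * Real.sqrt (Real.log (hbL X (hbTau ϖ X)))))⁻¹) ≤ T * 1 := by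
          refine mul_le_mul_of_nonneg_left ?_ hTpos.le
          rw [mul_inv_le_iff₀ hE, one_mul]; exact e3
      _ = T := mul_one T
  -- assemble
  have hsum : Y ^ (-(1 / 2 : ℝ)) + Y ^ 30 * X ^ (-(hbTau ϖ X / 4)) + Y ^ 8 * Q₁ ^ (-(1 / 8 : ℝ)) +
      Y ^ 8 * Q₁ ^ 2 * Real.exp (-(c₂ * Real.sqrt (Real.log (hbL X (hbTau ϖ X))))) ≤ 4 * T := by
    rw [h1]; linarith
  have hsum0 : 0 ≤ Y ^ (-(1 / 2 : ℝ)) + Y ^ 30 * X ^ (-(hbTau ϖ X / 4)) +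
      Y ^ 8 * Q₁ ^ (-(1 / 8 : ℝ)) +
      Y ^ 8 * Q₁ ^ 2 * Real.exp (-(c₂ * Real.sqrt (Real.log (hbL X (hbTau ϖ X))))) := by
    positivity
  have hLc : 0 ≤ Real.log X ^ c := Real.rpow_nonneg hLpos.le _
  have hC0 : C ≤ max C 0 := le_max_left _ _
  have hM0 : 0 ≤ max C 0 := le_max_right _ _
  refine hmain.trans ?_
  calc C * X ^ 2 * (Y ^ (-(1 / 2 : ℝ)) + Y ^ 30 * X ^ (-(hbTau ϖ X / 4)) +
          Y ^ 8 * Q₁ ^ (-(1 / 8 : ℝ)) +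
          Y ^ 8 * Q₁ ^ 2 * Real.exp (-(c₂ * Real.sqrt (Real.log (hbL X (hbTau ϖ X)))))) *
        Real.log X ^ c
      ≤ max C 0 * X ^ 2 * (Y ^ (-(1 / 2 : ℝ)) + Y ^ 30 * X ^ (-(hbTau ϖ X / 4)) +
          Y ^ 8 * Q₁ ^ (-(1 / 8 : ℝ)) +
          Y ^ 8 * Q₁ ^ 2 * Real.exp (-(c₂ * Real.sqrt (Real.log (hbL X (hbTau ϖ X)))))) *
        Real.log X ^ c :=
        mul_le_mul_of_nonneg_right (mul_le_mul_of_nonneg_right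
          (mul_le_mul_of_nonneg_right hC0 (by positivity)) hsum0) hLc
    _ ≤ max C 0 * X ^ 2 * (4 * T) * Real.log X ^ c :=
        mul_le_mul_of_nonneg_right (mul_le_mul_of_nonneg_left hsum (by positivity)) hLc
    _ = 4 * max C 0 * X ^ 2 * Q₁ ^ (-(1 / 160 : ℝ)) * Real.log X ^ c := by rw [hT]; ring

/-- **`h310` of `heathBrownMorozUniform_of_classLemmas`** (the class Type II estimate, (3.14) up to `d·Q₁`,
`d·Q₁ ≤ exp((log X)^{1/3})`) from the three Type II stubs: `class_310` with `Q₁ ≤ d·Q₁`. -/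
theorem h310_of (h3 : Sig.stub_classMainError) (h4 : Sig.stub_classMainCauchy)
    (h5 : Sig.stub_twistedSsum) :
    ∀ d a b : ℕ, 0 < d → a < d → b < d → Nat.Coprime (a ^ 3 + 2 * b ^ 3) d →
      ∀ ϖ : ℝ, 0 < ϖ → ϖ < 1 / 5 →
        ∃ c c₃ c₄ : ℝ, 0 < c₃ ∧ 0 < c₄ ∧ ∀ C₁ c₁ c₅ c₆ : ℝ, 0 < c₁ → 0 < c₅ → 0 < c₆ →
          ∃ C X₀ : ℝ, ∀ X η Q₁ : ℝ, X₀ ≤ X → Real.exp (-Real.log X ^ (1 / 3 : ℝ)) ≤ η → η ≤ 1 →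
            1 ≤ Q₁ → (d : ℝ) * Q₁ ≤ Real.exp (Real.log X ^ (1 / 3 : ℝ)) →
              (∀ (k' : ℕ) (m' : Fin k' → ℕ), CoreAdmissible (hbTau ϖ X) m' →
                Hyp314 X (hbTau ϖ X) m' ((d : ℝ) * Q₁) C₁ c₁ c₃ c₄) →
                ∀ (k : ℕ) (m : Fin k → ℕ), CoreAdmissible (hbTau ϖ X) m →
                  ∀ cR : Ideal (𝓞 K) → ℝ, CSupport X (hbTau ϖ X) cR →
                    ∀ V : ℝ, c₅ * X ^ (1 + hbTau ϖ X) ≤ V → V ≤ c₆ * X ^ (3 / 2 - hbTau ϖ X) →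
                      |bilin (classPairs X η d a b) pairIdeal cR
                          (fun S => if V < (Ideal.absNorm S : ℝ) ∧ (Ideal.absNorm S : ℝ) ≤ 2 * V then
                            fWeight X (hbTau ϖ X) m S else 0)| ≤
                        C * X ^ 2 * Q₁ ^ (-(1 / 160 : ℝ)) * Real.log X ^ c := by
  intro d a b hd _ha _hb _hadm ϖ hϖ0 hϖ5
  obtain ⟨c, c₃, c₄, hc₃, hc₄, H⟩ := class_310 h3 h4 h5 d a b hd ϖ hϖ0 hϖ5
  refine ⟨c, c₃, c₄, hc₃, hc₄, fun C₁ c₁ c₅ c₆ hc₁ hc₅ hc₆ => ?_⟩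
  obtain ⟨C, X₀, HX⟩ := H C₁ c₁ c₅ c₆ hc₁ hc₅ hc₆
  refine ⟨C, X₀, fun X η Q₁ hX hη1 hη2 hQ1 hdQ hHyp k m hm cR hcR V hV1 hV2 => ?_⟩
  have hd1 : (1 : ℝ) ≤ d := Nat.one_le_cast.mpr hd
  have hQd : Q₁ ≤ (d : ℝ) * Q₁ := le_mul_of_one_le_left (by linarith) hd1
  exact HX X η Q₁ hX hη1 hη2 hQ1 (hQd.trans hdQ) hHyp k m hm cR hcR V hV1 hV2

/-- **Bridge between the two readings.** The sibling line's fourth stub `ClassTypeIIBound` (= `h310` verbatim)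
is DISCHARGED by this line's three Type II stubs (definitional unfolding of `ClassTypeIIBound`; proof = `h310_of`). -/
theorem classTypeIIBound_of (h3 : Sig.stub_classMainError) (h4 : Sig.stub_classMainCauchy)
    (h5 : Sig.stub_twistedSsum) : ClassTypeIIBound :=
  h310_of h3 h4 h5

/-! ### S2 CLOSED (v4 quick win): EQ35 from the landed direct class Lemma 3.5 -/

/-- **The direct class Lemma 3.5 holds** (`ClassH35` = `h35` of `heathBrownMorozUniform_of_classLemmas`, verbatim):
LANDED as `Literature.NumberTheory.Sieve.CubicSieve.class_lemma_3_5` (p555871; via `class_typeI_A` → class level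
bound → class FL 𝒜-side; Mertens-K from `mertensK_grouped`). [cite: HeathBrownMoroz2004, Lemma 3.1] -/
theorem classH35_holds : ClassH35 :=
  fun _ _ _ hd ha hb hadm σ₀ hσ ϖ hϖ0 hϖ5 => class_lemma_3_5 hd ha hb hadm σ₀ hσ ϖ hϖ0 hϖ5

/-- **S2 (EQ35) holds** — the sibling line's stub signature `ClassFLDifferencing`, now a THEOREM: the direct class
Lemma 3.5 (`classH35_holds`) differenced against the parent's Lemma 3.5 by the sibling's PROVED
`classFLDifferencing_of_h35`. [cite: HeathBrownMoroz2004, Lemma 3.1] [cite: HeathBrownActa2001, Lemma 3.5] -/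
theorem flDifferencing_holds : ClassFLDifferencing :=
  classFLDifferencing_of_h35 classH35_holds

/-! ### v6 bookkeeping: every statement `def` of this file now has a closed witness -/

/-- **The class display (10.4) HOLDS** (S4b instantiated: S4a `classTypeISqfreeSum_holds` and S3 `sigmaOneCoprime_holds` fed to
the landed `classDisplay104_of_hyps`). [cite: HeathBrownActa2001, §10 (10.4)] [cite: HeathBrownMoroz2004, Lemma 4.1] -/
theorem classDisplay104_holds : ClassDisplay104 :=
  classDisplay104_of_hyps classTypeISqfreeSum_holds sigmaOneCoprime_holds

/-- **The class leading-parts differencing HOLDS** (the sibling's EQ39 node: `classLeadingDifferencing_of_display104` on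
`classDisplay104_holds`). [cite: HeathBrownActa2001, Lemma 3.9] [cite: HeathBrownMoroz2004, Lemma 4.1] -/
theorem classLeadingDifferencing_holds : ClassLeadingDifferencing :=
  classLeadingDifferencing_of_display104 classDisplay104_holds

/-! ### The compositions: the crux BY NAME (5-ary v4 form, 6-ary v3 form, sibling form, from E5 alone (v5), and — v6 — outright) -/

/-- **CRUX-PLAN composition (merged, v4 form; kept in v5/v6).** The hypotheses are the five v4 stub signatures BY NAME
(all five now theorems: `sigmaOneCoprime_holds`, `classDisplay104_of_hyps`, `classMainError_holds`, `classMainCauchy_holds`, `twistedSsum_holds`), the conclusion is literally the route decl; complete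
proof: `h35` by `h35_of_flDifferencing flDifferencing_holds` (S2 closed), `h39` by
`classLeadingDifferencing_of_display104` (S4a supplied by the PROVED `classTypeISqfreeSum_holds`) and
`h39_of_leadingDifferencing`, `h310` by `h310_of`, then the tree's `heathBrownMorozUniform_of_classLemmas`
(p544930).  Goldbach is not proved by this. [cite: HeathBrownMoroz2004, Theorem 2] -/
theorem HeathBrownMorozUniform_of :
    ClassSigmaOneCoprime → (ClassTypeISqfreeSum → ClassSigmaOneCoprime → ClassDisplay104) →
      Sig.stub_classMainError → Sig.stub_classMainCauchy → Sig.stub_twistedSsum →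
        Summit.Parity.GeneralizedHardyLittlewood.Theses.GoldbachHeathBrownDispersion.HeathBrownMorozUniform :=
  fun h3 h4 e3 e4 e5 =>
    heathBrownMorozUniform_of_classLemmas (h35_of_flDifferencing flDifferencing_holds)
      (h39_of_leadingDifferencing (classLeadingDifferencing_of_display104 (h4 classTypeISqfreeSum_holds h3)))
      (h310_of e3 e4 e5)

/-- The six-hypothesis form (EQ35 explicit), i.e. the v3 composition. -/
theorem HeathBrownMorozUniform_of₆ :
    ClassFLDifferencing → ClassSigmaOneCoprime → (ClassTypeISqfreeSum → ClassSigmaOneCoprime → ClassDisplay104) →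
      Sig.stub_classMainError → Sig.stub_classMainCauchy → Sig.stub_twistedSsum →
        Summit.Parity.GeneralizedHardyLittlewood.Theses.GoldbachHeathBrownDispersion.HeathBrownMorozUniform :=
  fun h2 h3 h4 e3 e4 e5 =>
    heathBrownMorozUniform_of_classLemmas (h35_of_flDifferencing h2)
      (h39_of_leadingDifferencing (classLeadingDifferencing_of_display104 (h4 classTypeISqfreeSum_holds h3)))
      (h310_of e3 e4 e5)

/-- **The sibling line's composition, VERBATIM** (`Lines/parent_differencing.lean`, `HeathBrownMorozUniform_of`):
four hypotheses, the fourth being `ClassTypeIIBound`; kept so that a prover reading either card finds its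
composition in the registered file. -/
theorem HeathBrownMorozUniform_of_parentLine (h₂ : ClassFLDifferencing) (h₃ : ClassSigmaOneCoprime)
    (h₄ : ClassTypeISqfreeSum → ClassSigmaOneCoprime → ClassDisplay104) (h₅ : ClassTypeIIBound) :
    Summit.Parity.GeneralizedHardyLittlewood.Theses.GoldbachHeathBrownDispersion.HeathBrownMorozUniform :=
  heathBrownMorozUniform_of_classLemmas (h35_of_flDifferencing h₂)
    (h39_of_leadingDifferencing (classLeadingDifferencing_of_display104 (h₄ classTypeISqfreeSum_holds h₃))) h₅

/-- **The crux from E5 alone (v5 form, kept).**  S3, S4b, E3, E4 are supplied by the landed theorems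
(`sigmaOneCoprime_holds`, `classDisplay104_of_hyps`, `classMainError_holds`, `classMainCauchy_holds`), S2/S4a by the proofs
above; the only hypothesis is the load-bearing stub signature `Sig.stub_twistedSsum` (itself a theorem since v6,
`twistedSsum_holds`).  Complete proof, no `sorry`.  Goldbach is not proved by this. [cite: HeathBrownMoroz2004, Theorem 2] -/
theorem HeathBrownMorozUniform_of_twisted (e5 : Sig.stub_twistedSsum) :
    Summit.Parity.GeneralizedHardyLittlewood.Theses.GoldbachHeathBrownDispersion.HeathBrownMorozUniform :=
  HeathBrownMorozUniform_of sigmaOneCoprime_holds classDisplay104_of_hyps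
    classMainError_holds classMainCauchy_holds e5

/-- The class Type II lemma `h310` (`ClassTypeIIBound`, the sibling's former fourth stub) from E5 alone (E3, E4 landed). -/
theorem classTypeIIBound_of_twisted (e5 : Sig.stub_twistedSsum) : ClassTypeIIBound :=
  classTypeIIBound_of classMainError_holds classMainCauchy_holds e5

/-- **The class Type II lemma `h310 = ClassTypeIIBound` HOLDS (v6)** — this line's target (Heath-Brown–Moroz 2004,
Prop. 4.2 (ii) / the class Lemma 3.10), from the three landed Type II theorems E3, E4, E5 and the proved bookkeeping
`h310_of`; no hypothesis, no `sorry`. [cite: HeathBrownMoroz2004, Proposition 4.2] [cite: HeathBrownActa2001, Lemma 3.10] -/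
theorem classTypeIIBound_holds : ClassTypeIIBound :=
  classTypeIIBound_of classMainError_holds classMainCauchy_holds twistedSsum_holds

/-- **LINE CLOSED (v6): the crux BY NAME, outright — no hypothesis, no `sorry`.**  The v5 composition
`HeathBrownMorozUniform_of_twisted` applied to the landed E5 (`twistedSsum_holds`, p565095): every one of the line's five
stubs is a landed `Theorems/` theorem and the glue is proved above, so this is a complete kernel-checked proof of
`Summit.Parity.GeneralizedHardyLittlewood.Theses.GoldbachHeathBrownDispersion.HeathBrownMorozUniform` (Heath-Brown–Moroz 2004,
Theorem 2 for `x³ + 2y³`, box exponent uniform over the classes of each modulus).  The ledger item closes through the lead's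
`Theorems/` copy of the same composition (Cruxes files are not importable).  **Goldbach is not proved by this** — the route's
leaf is the FRONTIER almost-all rung `GoldbachHeathBrownAlmostAll`, a formalisation of a 2004 theorem.
[cite: HeathBrownMoroz2004, Theorem 2] -/
theorem heathBrownMorozUniform_holds :
    Summit.Parity.GeneralizedHardyLittlewood.Theses.GoldbachHeathBrownDispersion.HeathBrownMorozUniform :=
  HeathBrownMorozUniform_of_twisted twistedSsum_holds

/-- Alias kept from v5 (`heathBrownMorozUniform_of_stubs` was the crux modulo the then-open E5; now identical to
`heathBrownMorozUniform_holds`, 0 `sorry`). -/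
theorem heathBrownMorozUniform_of_stubs :
    Summit.Parity.GeneralizedHardyLittlewood.Theses.GoldbachHeathBrownDispersion.HeathBrownMorozUniform :=
  heathBrownMorozUniform_holds

end Summit.Parity.GeneralizedHardyLittlewood.Cruxes.HeathBrownMorozUniform.UnitSplitPositivity

end
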